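import Literature.Barriers.Parity.LogarithmicAveraging
import HarnessLib

/-!
# Scope of the barrier `LogarithmicAveraging` (Hall 1996; Tao 2016; Tao–Teräväinen 2019):
# windows, almost all scales, and the bump–dip sequence

Audit companion (D-0021 barrier audit, 2026-08-16) of `Literature/Barriers/Parity/LogarithmicAveraging.lean`.
The catalogued barrier `Literature.Barriers.Parity.LogarithmicAveraging` is PROVED in the tree and is
CONFIRMED by the audit: every quotation in its block was checked on the page (Hall, *Sets of
Multiples*, PDF p. 11, (0.11)–(0.15); Tao 2016, arXiv pp. 3, 4, 9, 15; Tao–Teräväinen 2019, arXiv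
pp. 4–7 and Remark 1.23; Montgomery–Vaughan, PDF pp. 125–126 (Theorem 5.11 and the closing remarks of
§5.2) and p. 200 (Corollary 8.8)), and no unweighted two-point correlation estimate for `λ`, `μ` or
`Λ` valid at ALL scales has appeared. What this file adds is PROVED and closes the distance
between the barrier's `technique_class:` prose and its theorem:

1. **Windows.** The logarithmic methods output more than a logarithmic mean value: Tao's theorem is
   the WINDOWED statement `∑_{x/ω < n ≤ x} λ(n)λ(n+1)/n = o(log ω)` for every `ω = ω(x) → ∞`
   [cite: TaoFMP2016, Theorem 1.3], and Helfgott–Radziwiłł give it with the saving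
   `O(1/√(log log w))` [cite: HelfgottRadziwill2021, Corollary 1.5]; the theorem
   `LogarithmicAveraging` only refutes transfer from `HasLogMeanValue` (the full range `[1, X]`).
   Here: Hall's set has BOUNDED logarithmic discrepancy `|∑_{n ≤ X, n ∈ K} 1/n - (log X)/2| ≤ 3`
   (`hasBoundedLogDiscrepancy_hallSet`), bounded discrepancy controls every window
   (`HasBoundedLogDiscrepancy.abs_window_le`: `∑_{Y < n ≤ X} a(n)/n = α log(X/Y) + O(1)`), and
   so even the strongest conceivable logarithmic information gives no mean value on `{0,1}`-valued
   sequences (`not_windowToMeanTransfer_indicator`, `_bounded`, `_nonneg`).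
2. **Almost all scales.** The state of the art is UNWEIGHTED at almost all scales: the binary
   Elliott / two-point Chowla correlations are `≤ ε` outside a set of scales of logarithmic BANACH
   density zero [cite: TaoTeravainen2019AlmostAllScales, Corollary 1.13], and
   `(1/log w) ∫_{x/w}^x |S(t)| dt/t = O(1/√(log log w))` for the dyadic correlation `S`
   [cite: HelfgottRadziwill2021, Corollary 1.6]; "It would of course be desirable if we could
   upgrade "almost all scales" to "all scales" … We do not know how to do so in general"
   [cite: TaoTeravainen2019AlmostAllScales, §1 (p. 7)]. Here: the upgrade cannot be SOFT either —
   the bump–dip sequence (`BumpDip.seq`: value `1/2`, raised to `1` on `(2^{j²}, 2^{j²+1}]` and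
   lowered to `0` on `(2^{j²+1}, 2^{j²+2}]`, `j ≥ 1`) is `[0,1]`-valued, has bounded logarithmic
   discrepancy about `1/2` (`BumpDip.hasBoundedLogDiscrepancy_seq`), has Cesàro mean `1/2` at
   almost all scales with logarithmic-Banach-density-zero exceptional sets
   (`BumpDip.hasMeanValueAAS_seq`), and has NO mean value (`BumpDip.not_hasMeanValue_seq`); hence
   `not_aaScalesToMeanTransfer_unitInterval` (`_bounded`, `_nonneg`): no argument using of the
   correlation sequence only boundedness / non-negativity / `O(X)` partial sums, all windowed
   logarithmic statements AND the almost-all-scales statement reaches all scales.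
3. **The positive side** (what DOES suffice softly): "if one could show that the set `𝒳₀` has
   asymptotic density `0`, then `[1,∞) ∖ 𝒳₀` would intersect every interval `[x,(1+ε)x]` for all
   large `x`, which would easily imply … that the unweighted correlation converges to zero without
   any exceptional scales" [cite: TaoTeravainen2019AlmostAllScales, Remark 1.11] —
   `hasMeanValue_of_goodScale_nearby` (bounded `a`, a good scale in every `[X, (1+ε)X]` eventually
   ⟹ mean value), via the log-Lipschitz estimate `abs_cesaroMean_sub_le`.

## What the post-2016 sources print (arXiv versions; verified on the page)

* H. A. Helfgott, M. Radziwiłł, *Expansion, divisibility and parity*, arXiv:2103.06853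
  [cite: HelfgottRadziwill2021, Abstract, §1.1–1.2 and Corollaries 1.4–1.6]. Abstract: "we prove
  that a graph describing divisibility by primes is a strong local expander almost everywhere …
  we derive that `(1/log x) ∑_{n ≤ x} λ(n)λ(n+1)/n = O(1/√(log log x))`, improving on a result of
  Tao's. We also prove that `∑_{N < n ≤ 2N} λ(n)λ(n+1) = o(N)` at almost all scales". §1.2: "Tao
  remarks that "some sort of expander graph property" may hold for `Γ` … Tao does not establish
  an expansion property for `Γ` … He circumvents this obstacle with the entropy decrement
  method". Corollary 1.4: the expander identity at ONE dyadic scale `𝐍 = (N, 2N]` has left side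
  `(1/(N𝓛)) ∑_{p ∈ 𝐏} ∑_{N/p < n ≤ 2N/p} F₁(Ω(n)) F₂(Ω(n+1))` — a sum over the scales `N/p`,
  `p ∈ 𝐏`, `𝓛 = ∑_{p ∈ 𝐏} 1/p` — with error `O(1/√𝓛)`; "it directly implies estimates on
  expressions of the form `∑_{x/w < n ≤ x} F₁(Ω(n))F₂(Ω(n+1))/n`, as well as estimates on
  `∑_{x < n ≤ 2x} F₁(Ω(n))F₂(Ω(n+1))` valid "at almost all scales"". Corollary 1.5: "For any
  `e < w ≤ x` such that `w → ∞` as `x → ∞`, `(1/log w) ∑_{x/w ≤ n ≤ x} λ(n)λ(n+1)/n =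
  O(1/√(log log w))`". Corollary 1.6 (Chowla at almost all scales): with
  `S(x) = (1/x)∑_{x < n ≤ 2x} λ(n)λ(n+1)`, "`(1/log w) ∫_{x/w}^x |S(t)| dt/t = O(1/√(log log w))`".
* N. Frantzikinakis, B. Host, IMRN 2021 (arXiv:1804.08556) [cite: FrantzikinakisHost2019, §1 (before Theorem 1.5)]:
  Tao's identity "allows to express an arbitrary joint correlation of multiplicative functions as
  a weighted average of their dilated joint correlations taken over all prime dilates (this step
  necessitates the use of logarithmic averages)"; all theorems there are logarithmically averaged.
* T. Tao, Forum Math. Pi 4 (2016) [cite: TaoFMP2016, §1 (p. 3)]: "Using the multiplicativity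
  `λ(pn) = -λ(n)`, we conclude that `∑_{n ≤ x} λ(n)λ(n+p)1_{p|n}/n` is also large … note here how
  the logarithmic averaging allows us to leave the constraint `n ≤ x` unchanged."
* T. Tao, J. Teräväinen, Algebra & Number Theory 13 (2019) [cite: TaoTeravainen2019AlmostAllScales, Corollary 1.8 (i), Remarks 1.10–1.11, Corollary 1.13, Theorem 1.17].
  Corollary 1.8 (i) / 1.13 (i): "`|𝔼_{n ≤ X} g₁(n+h₁)g₂(n+h₂)| ≤ ε` for all natural numbers `X`
  outside of a set `𝒳_ε` of logarithmic Banach density zero, in the sense that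
  `lim_{ω→∞} sup_{X ≥ ω} 𝔼^{log}_{X/ω ≤ n ≤ X} 1_{𝒳_ε}(n) = 0`". Remark 1.10: almost all scales
  implies the windowed logarithmic statement by partial summation, "Thus Corollary 1.8 is a
  strengthening of our earlier result". Remark 1.11: "The logarithmic density (or logarithmic
  Banach density) … is the right density to consider in this problem. Namely, if one could show
  that the set `𝒳₀` has asymptotic density `0`, then … the unweighted correlation converges to
  zero without any exceptional scales." Theorem 1.17 (Few sign patterns implies binary Chowla
  conjecture): fewer than `exp(εK/log K)` sign patterns of length `K` for arbitrarily large `K`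
  gives `lim_X 𝔼_{n ≤ X} λ(n)λ(n+h) = 0` at ALL scales.
* O. Klurman, A. P. Mangerel, J. Teräväinen, arXiv:2304.05344 [cite: KlurmanMangerelTeravainen2023, Theorems 1.2, 1.6, 2.1 and 4.1].
  Theorems 1.2/1.6: two-point / moderately-non-pretentious Elliott at almost all scales
  (`δ⁺_log = 1`, resp. `δ⁺_loglog = 1`). Theorem 2.1: for `f = (−1)^{Ω_𝒫(n)}` with `𝒫` of
  relative density `0` in the primes and `∑_{p ∈ 𝒫} 1/p = ∞`, "`lim_x (1/x)∑_{n ≤ x}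
  f(a₁n+h₁)⋯f(a_kn+h_k) = 0`" — UNWEIGHTED, all scales; via Theorem 4.1 (every `x ≥ 3`, functions
  with `𝔻(f_j, χ_j(n)n^{it_j}; x^ε, x) ≤ ε`: pretentious at large primes; fundamental lemma of the
  sieve) — a structural input outside the technique class, inapplicable to `λ`, `μ`, `Λ`.

## Main statements (all PROVED)

* `HasBoundedLogDiscrepancy`, `HasBoundedLogDiscrepancy.abs_window_le`,
  `hasBoundedLogDiscrepancy_hallSet`, `WindowToMeanTransfer`, `not_windowToMeanTransfer_indicator`
  (`_bounded`, `_nonneg`);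
* `abs_cesaroMean_sub_le`, `hasMeanValue_of_goodScale_nearby` (TT Remark 1.11, positive);
* `windowMass`, `HasLogBanachDensityZero`, `HasMeanValueAAS` (TT Corollary 1.13 (i) shape),
  `HasMeanValue.hasMeanValueAAS` (sanity), `AAScalesToMeanTransfer`;
* `BumpDip.seq` with `BumpDip.not_hasMeanValue_seq`, `BumpDip.hasBoundedLogDiscrepancy_seq`,
  `BumpDip.hasMeanValueAAS_seq`; `not_aaScalesToMeanTransfer_unitInterval` (`_bounded`, `_nonneg`);
* `LogarithmicAveragingScope` — the catalogue record (docstring = BARRIER block), PROVED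
  (`LogarithmicAveragingScope_holds`).

Design. Elementary real analysis on `Finset.Icc 1 X` sums, reusing `cesaroMean`, `psum`,
`blockLog`, `hallSet` and the harmonic block estimates of `LogarithmicAveraging.lean`. The
logarithmic Banach density is normalised by `log ω` (Tao–Teräväinen divide by
`∑_{X/ω ≤ n ≤ X} 1/n = log ω + O(1)`; the two notions of "density zero" coincide). The bump–dip
sequence takes the value `1/2` off the bumps and dips (a `{0,1}`-valued variant uses the even
numbers instead; not formalised); its exceptional scales at level `ε` lie in
`⋃_{j ≥ 1} (2^{j²}, 2^{j²+1}/ε]`, which meets a window of multiplicative width `ω` in at most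
`d + 1` pieces, `d² ≤ log₂ ⌊2ω/ε⌋`, each of logarithmic mass `≤ 1 + log(2/ε)`.

Not here: Remark 1.10's partial summation (almost all scales ⟹ windowed logarithmic statement)
and the Dirichlet-series side (`a_n = 1 + cos log n`: non-negative, `∑ a_n n^{-s} - ζ(s)` analytic
near `s = 1`, no mean value) are quoted only; nothing is claimed about `λ(n)λ(n+h)` or
`Λ(n)Λ(n+h)` themselves.
-/

noncomputable section

open Filter Finset Topology

namespace Literature.Barriers.Parity

/-! ## Bounded logarithmic discrepancy -/

/-- `a` has BOUNDED logarithmic discrepancy about `α`: `|∑_{n ≤ X} a(n)/n - α log X| ≤ C` for all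
`X ≥ 1`. [folklore] -/
def HasBoundedLogDiscrepancy (a : ℕ → ℝ) (α : ℝ) : Prop :=
  ∃ C : ℝ, ∀ X : ℕ, 1 ≤ X → |∑ n ∈ Icc 1 X, a n / n - α * Real.log X| ≤ C

/-- Bounded discrepancy implies the logarithmic mean value. [folklore] -/
theorem HasBoundedLogDiscrepancy.hasLogMeanValue {a : ℕ → ℝ} {α : ℝ}
    (h : HasBoundedLogDiscrepancy a α) : HasLogMeanValue a α := by
  obtain ⟨C, hC⟩ := h
  have hlog : Tendsto (fun X : ℕ => Real.log (X : ℝ)) atTop atTop :=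
    Real.tendsto_log_atTop.comp tendsto_natCast_atTop_atTop
  have hbound : Tendsto (fun X : ℕ => C / Real.log (X : ℝ)) atTop (𝓝 0) :=
    tendsto_const_nhds.div_atTop hlog
  have hkey : Tendsto (fun X : ℕ => logMean a X - α) atTop (𝓝 0) := by
    refine squeeze_zero_norm' ?_ hbound
    filter_upwards [eventually_ge_atTop 2] with X hX
    have hlogpos : 0 < Real.log (X : ℝ) := Real.log_pos (by exact_mod_cast hX)
    have h1 := hC X (by omega)
    rw [Real.norm_eq_abs]
    have : logMean a X - α = (∑ n ∈ Icc 1 X, a n / n - α * Real.log X) / Real.log X := by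
      unfold logMean; field_simp
    rw [this, abs_div, abs_of_pos hlogpos]
    exact div_le_div_of_nonneg_right h1 hlogpos.le
  have := hkey.add_const α
  simp only [zero_add, sub_add_cancel] at this
  exact this

/-- Splitting `∑_{n ≤ X}` at `Y ≤ X`. [folklore] -/
lemma sum_Icc_one_eq_add_sum_Ioc (f : ℕ → ℝ) {Y X : ℕ} (hYX : Y ≤ X) :
    ∑ n ∈ Icc 1 X, f n = ∑ n ∈ Icc 1 Y, f n + ∑ n ∈ Ioc Y X, f n := by
  rw [Icc_one_eq_Ioc_zero, Icc_one_eq_Ioc_zero,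
    Finset.sum_Ioc_consecutive f (Nat.zero_le _) hYX]

/-- **Windows.** Bounded discrepancy controls EVERY multiplicative window `(Y, X]`:
`|∑_{Y < n ≤ X} a(n)/n - α log(X/Y)| ≤ 2C` — in particular `∑_{x/ω < n ≤ x} a(n)/n = α log ω + O(1)`
uniformly, the shape of the windowed logarithmic statements. [cite: TaoFMP2016, Theorem 1.3] -/
theorem HasBoundedLogDiscrepancy.abs_window_le {a : ℕ → ℝ} {α : ℝ}
    (h : HasBoundedLogDiscrepancy a α) :
    ∃ C : ℝ, ∀ Y X : ℕ, 1 ≤ Y → Y ≤ X →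
      |∑ n ∈ Ioc Y X, a n / n - α * (Real.log X - Real.log Y)| ≤ C := by
  obtain ⟨C, hC⟩ := h
  refine ⟨C + C, fun Y X hY hYX => ?_⟩
  have hX := hC X (le_trans hY hYX)
  have hY' := hC Y hY
  have hsplit := sum_Icc_one_eq_add_sum_Ioc (fun n => a n / n) hYX
  have : ∑ n ∈ Ioc Y X, a n / n - α * (Real.log X - Real.log Y) =
      (∑ n ∈ Icc 1 X, a n / n - α * Real.log X) - (∑ n ∈ Icc 1 Y, a n / n - α * Real.log Y) := by
    rw [hsplit]; ring
  rw [this]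
  exact (abs_sub _ _).trans (add_le_add hX hY')

/-- **Hall's set has bounded logarithmic discrepancy** about `1/2` (`|∑_{n ≤ X, n ∈ K} 1/n - (log X)/2| ≤ 3`).
[cite: Hall1996SetsOfMultiples, §0.3 (0.15)] -/
theorem hasBoundedLogDiscrepancy_hallSet :
    HasBoundedLogDiscrepancy (hallSet.indicator (1 : ℕ → ℝ)) (1 / 2) := by
  refine ⟨3, fun X hX => ?_⟩
  have h := abs_hallLogSum_sub_half_log_le hX
  have : ∑ n ∈ Icc 1 X, hallSet.indicator (1 : ℕ → ℝ) n / n - 1 / 2 * Real.log X =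
      hallLogSum X - Real.log X / 2 := by
    unfold hallLogSum; ring
  rw [this]; exact h

/-- **The window-to-mean transfer schema** on a class `𝒞`: every `a ∈ 𝒞` with BOUNDED logarithmic
discrepancy about `α` (hence `α log ω + O(1)` on every window `(x/ω, x]`) has Cesàro mean value `α`.
A weaker schema (stronger hypothesis) than `LogToMeanTransfer`.
[cite: TaoTeravainen2019AlmostAllScales, §1 (p. 5) and Remark 1.10] -/
def WindowToMeanTransfer (𝒞 : Set (ℕ → ℝ)) : Prop :=
  ∀ a ∈ 𝒞, ∀ α : ℝ, HasBoundedLogDiscrepancy a α → HasMeanValue a α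

/-- `LogToMeanTransfer 𝒞 → WindowToMeanTransfer 𝒞`. [folklore] -/
theorem LogToMeanTransfer.windowToMeanTransfer {𝒞 : Set (ℕ → ℝ)} (h : LogToMeanTransfer 𝒞) :
    WindowToMeanTransfer 𝒞 :=
  fun a ha α hα => h a ha α hα.hasLogMeanValue

/-- Monotonicity in the class. [folklore] -/
theorem WindowToMeanTransfer.mono {𝒞 𝒟 : Set (ℕ → ℝ)} (h : WindowToMeanTransfer 𝒟) (hsub : 𝒞 ⊆ 𝒟) :
    WindowToMeanTransfer 𝒞 :=
  fun a ha α hα => h a (hsub ha) α hα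

/-- **No window-to-mean transfer on `{0,1}`-valued sequences**: Hall's set.
[cite: Hall1996SetsOfMultiples, §0.3 (0.14)–(0.15)] -/
theorem not_windowToMeanTransfer_indicator :
    ¬ WindowToMeanTransfer {a : ℕ → ℝ | ∀ n, a n = 0 ∨ a n = 1} := fun hT =>
  not_hasNaturalDensity_hallSet (1 / 2)
    (hT _ indicator_hallSet_mem_zeroOne (1 / 2) hasBoundedLogDiscrepancy_hallSet)

/-- No window-to-mean transfer on `1`-bounded sequences.
[cite: Hall1996SetsOfMultiples, §0.3 (0.14)–(0.15)] -/
theorem not_windowToMeanTransfer_bounded :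
    ¬ WindowToMeanTransfer {a : ℕ → ℝ | ∀ n, |a n| ≤ 1} := by
  intro h
  refine not_windowToMeanTransfer_indicator (h.mono fun a ha n => ?_)
  rcases ha n with h0 | h1
  · simp [h0]
  · simp [h1]

/-- No window-to-mean transfer on non-negative sequences with partial sums `≤ X`.
[cite: Hall1996SetsOfMultiples, §0.3 (0.14)–(0.15)] -/
theorem not_windowToMeanTransfer_nonneg :
    ¬ WindowToMeanTransfer {a : ℕ → ℝ | (∀ n, 0 ≤ a n) ∧ ∀ X, ∑ n ∈ Icc 1 X, a n ≤ X} := by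
  intro h
  refine not_windowToMeanTransfer_indicator (h.mono fun a ha => ⟨fun n => ?_, fun X => ?_⟩)
  · rcases ha n with h0 | h1
    · simp [h0]
    · simp [h1]
  · calc ∑ n ∈ Icc 1 X, a n ≤ ∑ n ∈ Icc 1 X, (1 : ℝ) :=
          Finset.sum_le_sum fun n _ => by
            rcases ha n with h0 | h1
            · simp [h0]
            · simp [h1]
      _ = X := by simp

/-! ## The positive side: a good scale in every short interval suffices (TT Remark 1.11) -/

/-- Log-Lipschitz property of Cesàro means of bounded sequences:
`|𝔼_{n ≤ X'} a - 𝔼_{n ≤ X} a| ≤ 2B (X' - X)/X'` for `1 ≤ X ≤ X'`.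
[cite: TaoTeravainen2019AlmostAllScales, Remark 1.11] -/
theorem abs_cesaroMean_sub_le {a : ℕ → ℝ} {B : ℝ} (hB : ∀ n, |a n| ≤ B) {X X' : ℕ}
    (hX : 1 ≤ X) (hXX' : X ≤ X') :
    |cesaroMean a X' - cesaroMean a X| ≤ 2 * B * (((X' : ℝ) - X) / X') := by
  have hB0 : 0 ≤ B := (abs_nonneg _).trans (hB 0)
  have hXr : (0 : ℝ) < X := by exact_mod_cast hX
  have hX'r : (0 : ℝ) < X' := by exact_mod_cast (lt_of_lt_of_le hX hXX')
  have hsplit : psum a X' = psum a X + ∑ n ∈ Ioc X X', a n :=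
    sum_Icc_one_eq_add_sum_Ioc a hXX'
  have hs : |∑ n ∈ Ioc X X', a n| ≤ B * ((X' : ℝ) - X) := by
    refine (Finset.abs_sum_le_sum_abs _ _).trans ?_
    calc ∑ n ∈ Ioc X X', |a n| ≤ ∑ n ∈ Ioc X X', B := Finset.sum_le_sum fun n _ => hB n
      _ = B * ((X' : ℝ) - X) := by
          rw [Finset.sum_const, nsmul_eq_mul, Nat.card_Ioc, Nat.cast_sub hXX']; ring
  have hp : |psum a X| ≤ B * X := abs_psum_le hB X
  rw [cesaroMean_eq, cesaroMean_eq, hsplit]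
  have hid : (psum a X + ∑ n ∈ Ioc X X', a n) / X' - psum a X / X =
      (∑ n ∈ Ioc X X', a n) / X' - psum a X * (((X' : ℝ) - X) / (X * X')) := by
    field_simp; ring
  rw [hid]
  refine (abs_sub _ _).trans ?_
  rw [abs_div, Nat.abs_cast, abs_mul, abs_div, abs_mul, Nat.abs_cast, Nat.abs_cast,
    abs_of_nonneg (by rw [sub_nonneg]; exact_mod_cast hXX' : (0 : ℝ) ≤ (X' : ℝ) - X)]
  have h1 : |∑ n ∈ Ioc X X', a n| / (X' : ℝ) ≤ B * (((X' : ℝ) - X) / X') := by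
    rw [div_le_iff₀ hX'r]
    calc |∑ n ∈ Ioc X X', a n| ≤ B * ((X' : ℝ) - X) := hs
      _ = B * (((X' : ℝ) - X) / X') * X' := by field_simp
  have h2 : |psum a X| * (((X' : ℝ) - X) / (X * X')) ≤ B * (((X' : ℝ) - X) / X') := by
    calc |psum a X| * (((X' : ℝ) - X) / (X * X'))
        ≤ B * X * (((X' : ℝ) - X) / (X * X')) :=
          mul_le_mul_of_nonneg_right hp
            (div_nonneg (sub_nonneg.2 (by exact_mod_cast hXX')) (by positivity))
      _ = B * (((X' : ℝ) - X) / X') := by field_simp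
  linarith

/-- **A good scale in every short interval gives all scales** (Tao–Teräväinen, Remark 1.11: an
exceptional set of scales of ASYMPTOTIC density zero "would easily imply … that the unweighted
correlation converges … without any exceptional scales"): if `a` is bounded and for every `ε > 0`,
eventually every interval `[X, (1+ε)X]` contains a scale `X'` with `|𝔼_{n ≤ X'} a - α| ≤ ε`, then
`𝔼_{n ≤ X} a → α`. [cite: TaoTeravainen2019AlmostAllScales, Remark 1.11] -/
theorem hasMeanValue_of_goodScale_nearby {a : ℕ → ℝ} {B α : ℝ} (hB : ∀ n, |a n| ≤ B)
    (h : ∀ ε : ℝ, 0 < ε → ∃ X₀ : ℕ, ∀ X : ℕ, X₀ ≤ X →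
      ∃ X' : ℕ, X ≤ X' ∧ (X' : ℝ) ≤ (1 + ε) * X ∧ |cesaroMean a X' - α| ≤ ε) :
    HasMeanValue a α := by
  have hB0 : 0 ≤ B := (abs_nonneg _).trans (hB 0)
  rw [HasMeanValue, Metric.tendsto_atTop]
  intro ε hε
  set ε₁ : ℝ := ε / (2 * B + 2) with hε₁
  have hε₁pos : 0 < ε₁ := by positivity
  obtain ⟨X₀, hX₀⟩ := h ε₁ hε₁pos
  refine ⟨max X₀ 1, fun X hX => ?_⟩
  obtain ⟨X', hXX', hX'le, hgood⟩ := hX₀ X (le_trans (le_max_left _ _) hX)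
  have hX1 : 1 ≤ X := le_trans (le_max_right _ _) hX
  have hXr : (0 : ℝ) < X := by exact_mod_cast hX1
  have hX'r : (0 : ℝ) < X' := by exact_mod_cast (lt_of_lt_of_le hX1 hXX')
  have hlip := abs_cesaroMean_sub_le hB hX1 hXX'
  have hratio : ((X' : ℝ) - X) / X' ≤ ε₁ := by
    rw [div_le_iff₀ hX'r]
    have : (X : ℝ) ≤ X' := by exact_mod_cast hXX'
    nlinarith
  rw [Real.dist_eq]
  calc |cesaroMean a X - α|
      ≤ |cesaroMean a X' - cesaroMean a X| + |cesaroMean a X' - α| := by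
        have := abs_sub_le (cesaroMean a X) (cesaroMean a X') α
        rw [abs_sub_comm (cesaroMean a X) (cesaroMean a X')] at this
        exact this
    _ ≤ 2 * B * ε₁ + ε₁ := by
        refine add_le_add (hlip.trans ?_) hgood
        exact mul_le_mul_of_nonneg_left hratio (by positivity)
    _ = ε * ((2 * B + 1) / (2 * B + 2)) := by rw [hε₁]; field_simp
    _ < ε := by
        have : (2 * B + 1) / (2 * B + 2) < 1 := by
          rw [div_lt_one (by positivity)]; linarith
        nlinarith

end Literature.Barriers.Parity

namespace Literature.Barriers.Parity

namespace BumpDip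

/-! ### Bump and dip block indices -/

/-- Bump blocks: `k = j²`, `j ≥ 1`. [folklore] -/
def IsBump (k : ℕ) : Prop := ∃ j, 1 ≤ j ∧ k = j ^ 2

/-- Dip blocks: `k = j² + 1`, `j ≥ 1` (the block right after a bump). [folklore] -/
def IsDip (k : ℕ) : Prop := ∃ j, 1 ≤ j ∧ k = j ^ 2 + 1

/-- `k` is a dip iff `k ≥ 1` and `k - 1` is a bump. [folklore] -/
lemma isDip_iff {k : ℕ} : IsDip k ↔ 1 ≤ k ∧ IsBump (k - 1) := by
  constructor
  · rintro ⟨j, hj, rfl⟩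
    exact ⟨by omega, j, hj, by omega⟩
  · rintro ⟨hk, j, hj, hj2⟩
    exact ⟨j, hj, by omega⟩

/-- `0` is not a bump. [folklore] -/
lemma not_isBump_zero : ¬ IsBump 0 := by
  rintro ⟨j, hj, h⟩
  have : 1 ≤ j ^ 2 := Nat.one_le_pow _ _ hj
  omega

/-- `0` is not a dip. [folklore] -/
lemma not_isDip_zero : ¬ IsDip 0 := by
  rintro ⟨j, -, h⟩
  omega

/-- `j'² + 1` is never a positive square. [folklore] -/
lemma sq_ne_sq_add_one {j j' : ℕ} (hj' : 1 ≤ j') : j ^ 2 ≠ j' ^ 2 + 1 := by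
  intro h
  have h1 : j' < j := by
    by_contra hle
    rw [not_lt] at hle
    have : j ^ 2 ≤ j' ^ 2 := Nat.pow_le_pow_left hle 2
    omega
  have h2 : (j' + 1) ^ 2 ≤ j ^ 2 := Nat.pow_le_pow_left h1 2
  have h3 : (j' + 1) ^ 2 = j' ^ 2 + 2 * j' + 1 := by ring
  omega

/-- A bump is not a dip. [folklore] -/
lemma IsBump.not_isDip {k : ℕ} (hb : IsBump k) : ¬ IsDip k := by
  rintro ⟨j', hj', rfl⟩
  obtain ⟨j, -, hjj⟩ := hb
  exact sq_ne_sq_add_one hj' hjj.symm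

/-- Two consecutive indices are never both bumps. [folklore] -/
lemma IsBump.not_isBump_pred {k : ℕ} (hb : IsBump k) : ¬ IsBump (k - 1) := by
  rintro ⟨j', hj', hk'⟩
  obtain ⟨j, hj, rfl⟩ := hb
  have hj2 : 1 ≤ j ^ 2 := Nat.one_le_pow _ _ hj
  exact sq_ne_sq_add_one (j := j) hj' (by omega)

/-! ### Block coefficients and the sequence -/

open Classical in
/-- The value of the sequence on the dyadic block `(2^k, 2^{k+1}]`: `1` on bumps, `0` on dips,
`1/2` elsewhere. [folklore] -/
def coef (k : ℕ) : ℝ := if IsBump k then 1 else if IsDip k then 0 else 1 / 2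

/-- `coef = 1` on bumps. [folklore] -/
lemma coef_of_isBump {k : ℕ} (h : IsBump k) : coef k = 1 := by
  simp [coef, h]

/-- `coef = 0` on dips. [folklore] -/
lemma coef_of_isDip {k : ℕ} (h : IsDip k) : coef k = 0 := by
  have hb : ¬ IsBump k := fun hb => hb.not_isDip h
  simp [coef, h, hb]

/-- `coef = 1/2` off bumps and dips. [folklore] -/
lemma coef_of_not {k : ℕ} (hb : ¬ IsBump k) (hd : ¬ IsDip k) : coef k = 1 / 2 := by
  simp [coef, hb, hd]

/-- `0 ≤ coef`. [folklore] -/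
lemma coef_nonneg (k : ℕ) : 0 ≤ coef k := by
  unfold coef; split_ifs <;> norm_num

/-- `coef ≤ 1`. [folklore] -/
lemma coef_le_one (k : ℕ) : coef k ≤ 1 := by
  unfold coef; split_ifs <;> norm_num

/-- The union of the bump blocks. [folklore] -/
def bumpSet : Set ℕ := {n | ∃ k, IsBump k ∧ 2 ^ k < n ∧ n ≤ 2 ^ (k + 1)}

/-- The union of the dip blocks. [folklore] -/
def dipSet : Set ℕ := {n | ∃ k, IsDip k ∧ 2 ^ k < n ∧ n ≤ 2 ^ (k + 1)}

/-- **The bump–dip sequence**: `1/2`, raised to `1` on the bump blocks `(2^{j²}, 2^{j²+1}]` and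
lowered to `0` on the dip blocks `(2^{j²+1}, 2^{j²+2}]`, `j ≥ 1`. [folklore] -/
def seq (n : ℕ) : ℝ :=
  1 / 2 + (1 / 2) * bumpSet.indicator 1 n - (1 / 2) * dipSet.indicator 1 n

/-- Dyadic blocks are determined by any of their elements. [folklore] -/
lemma block_unique {k k' n : ℕ} (h1 : 2 ^ k < n) (h2 : n ≤ 2 ^ (k + 1)) (h1' : 2 ^ k' < n)
    (h2' : n ≤ 2 ^ (k' + 1)) : k' = k := by
  have a : k' < k + 1 :=
    (Nat.pow_lt_pow_iff_right (by norm_num : 1 < 2)).1 (lt_of_lt_of_le h1' h2)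
  have b : k < k' + 1 :=
    (Nat.pow_lt_pow_iff_right (by norm_num : 1 < 2)).1 (lt_of_lt_of_le h1 h2')
  omega

/-- On the block `(2^k, 2^{k+1}]`, membership in `bumpSet` is `IsBump k`. [folklore] -/
lemma mem_bumpSet_iff_of_mem_block {k n : ℕ} (h1 : 2 ^ k < n) (h2 : n ≤ 2 ^ (k + 1)) :
    n ∈ bumpSet ↔ IsBump k := by
  constructor
  · rintro ⟨k', hk', h1', h2'⟩
    exact block_unique h1 h2 h1' h2' ▸ hk'
  · exact fun hk => ⟨k, hk, h1, h2⟩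

/-- On the block `(2^k, 2^{k+1}]`, membership in `dipSet` is `IsDip k`. [folklore] -/
lemma mem_dipSet_iff_of_mem_block {k n : ℕ} (h1 : 2 ^ k < n) (h2 : n ≤ 2 ^ (k + 1)) :
    n ∈ dipSet ↔ IsDip k := by
  constructor
  · rintro ⟨k', hk', h1', h2'⟩
    exact block_unique h1 h2 h1' h2' ▸ hk'
  · exact fun hk => ⟨k, hk, h1, h2⟩

/-- On the block `(2^k, 2^{k+1}]` the sequence is the constant `coef k`. [folklore] -/
lemma seq_of_mem_block {k n : ℕ} (h1 : 2 ^ k < n) (h2 : n ≤ 2 ^ (k + 1)) : seq n = coef k := by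
  unfold seq
  by_cases hb : IsBump k
  · rw [Set.indicator_of_mem ((mem_bumpSet_iff_of_mem_block h1 h2).2 hb),
      Set.indicator_of_notMem (fun h => hb.not_isDip ((mem_dipSet_iff_of_mem_block h1 h2).1 h)),
      coef_of_isBump hb]
    simp
    norm_num
  · rw [Set.indicator_of_notMem (fun h => hb ((mem_bumpSet_iff_of_mem_block h1 h2).1 h))]
    by_cases hd : IsDip k
    · rw [Set.indicator_of_mem ((mem_dipSet_iff_of_mem_block h1 h2).2 hd), coef_of_isDip hd]
      simp
    · rw [Set.indicator_of_notMem (fun h => hd ((mem_dipSet_iff_of_mem_block h1 h2).1 h)),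
        coef_of_not hb hd]
      simp

/-- `1` is in no bump block. [folklore] -/
lemma one_not_mem_bumpSet : 1 ∉ bumpSet := by
  rintro ⟨k, -, hk, -⟩
  exact absurd hk (not_lt.2 Nat.one_le_two_pow)

/-- `1` is in no dip block. [folklore] -/
lemma one_not_mem_dipSet : 1 ∉ dipSet := by
  rintro ⟨k, -, hk, -⟩
  exact absurd hk (not_lt.2 Nat.one_le_two_pow)

/-- `0` is in no bump block. [folklore] -/
lemma zero_not_mem_bumpSet : 0 ∉ bumpSet := by
  rintro ⟨k, -, hk, -⟩
  exact absurd hk (Nat.not_lt_zero _)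

/-- `0` is in no dip block. [folklore] -/
lemma zero_not_mem_dipSet : 0 ∉ dipSet := by
  rintro ⟨k, -, hk, -⟩
  exact absurd hk (Nat.not_lt_zero _)

/-- `seq 1 = 1/2`. [folklore] -/
lemma seq_one : seq 1 = 1 / 2 := by
  simp [seq, Set.indicator_of_notMem one_not_mem_bumpSet, Set.indicator_of_notMem one_not_mem_dipSet]

/-- `seq 0 = 1/2` (junk index, never summed). [folklore] -/
lemma seq_zero : seq 0 = 1 / 2 := by
  simp [seq, Set.indicator_of_notMem zero_not_mem_bumpSet, Set.indicator_of_notMem zero_not_mem_dipSet]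

/-- Every `n ≥ 2` lies in the block `k = log₂ (n - 1)`. [folklore] -/
lemma exists_block {n : ℕ} (hn : 2 ≤ n) : ∃ k, 2 ^ k < n ∧ n ≤ 2 ^ (k + 1) := by
  refine ⟨Nat.log 2 (n - 1), ?_, ?_⟩
  · have := Nat.pow_log_le_self 2 (show n - 1 ≠ 0 by omega)
    omega
  · have := Nat.lt_pow_succ_log_self (show 1 < 2 by norm_num) (n - 1)
    omega

/-- The bump–dip sequence is `[0,1]`-valued. [folklore] -/
lemma seq_mem_Icc (n : ℕ) : seq n ∈ Set.Icc (0 : ℝ) 1 := by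
  rcases Nat.lt_or_ge n 2 with hn | hn
  · interval_cases n
    · rw [seq_zero]; norm_num
    · rw [seq_one]; norm_num
  · obtain ⟨k, h1, h2⟩ := exists_block hn
    rw [seq_of_mem_block h1 h2]
    exact ⟨coef_nonneg k, coef_le_one k⟩

/-- `0 ≤ seq`. [folklore] -/
lemma seq_nonneg (n : ℕ) : 0 ≤ seq n := (seq_mem_Icc n).1

/-- `seq ≤ 1`. [folklore] -/
lemma seq_le_one (n : ℕ) : seq n ≤ 1 := (seq_mem_Icc n).2

/-! ### Block sums -/

/-- The block `(2^k, 2^{k+1}]` has `2^k` elements. [folklore] -/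
lemma card_block (k : ℕ) : ((Ioc (2 ^ k) (2 ^ (k + 1))).card : ℝ) = (2 : ℝ) ^ k := by
  rw [Nat.card_Ioc]
  have : 2 ^ (k + 1) - 2 ^ k = 2 ^ k := by rw [pow_succ]; omega
  rw [this]; push_cast; ring

/-- `∑_{2^k < n ≤ 2^{k+1}} seq(n) = coef(k) 2^k`. [folklore] -/
lemma sum_block_seq (k : ℕ) : ∑ n ∈ Ioc (2 ^ k) (2 ^ (k + 1)), seq n = coef k * (2 : ℝ) ^ k := by
  rw [← card_block, Finset.card_eq_sum_ones, Nat.cast_sum, Finset.mul_sum]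
  refine Finset.sum_congr rfl fun n hn => ?_
  rw [mem_Ioc] at hn
  rw [seq_of_mem_block hn.1 hn.2]; simp

/-- `∑_{2^k < n ≤ 2^{k+1}} seq(n)/n = coef(k) h_k`. [folklore] -/
lemma sum_block_seq_div (k : ℕ) :
    ∑ n ∈ Ioc (2 ^ k) (2 ^ (k + 1)), seq n / n = coef k * blockLog k := by
  unfold blockLog
  rw [Finset.mul_sum]
  refine Finset.sum_congr rfl fun n hn => ?_
  rw [mem_Ioc] at hn
  rw [seq_of_mem_block hn.1 hn.2]; ring

/-! ### Partial sums and the absence of a mean value -/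

/-- Counting recursion: `S(2^{K+1}) = S(2^K) + coef(K) 2^K`. [folklore] -/
lemma psum_seq_pow_succ (K : ℕ) :
    psum seq (2 ^ (K + 1)) = psum seq (2 ^ K) + coef K * (2 : ℝ) ^ K := by
  unfold psum
  rw [sum_Icc_one_pow_succ, sum_block_seq]

/-- Partial sums of `seq` are non-negative. [folklore] -/
lemma psum_seq_nonneg (X : ℕ) : 0 ≤ psum seq X :=
  Finset.sum_nonneg fun n _ => seq_nonneg n

/-- `j²` is a bump for `j ≥ 1`. [folklore] -/
lemma isBump_sq (j : ℕ) (hj : 1 ≤ j) : IsBump (j ^ 2) := ⟨j, hj, rfl⟩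

/-- `j² + 1` is a dip for `j ≥ 1`. [folklore] -/
lemma isDip_sq_add_one (j : ℕ) (hj : 1 ≤ j) : IsDip (j ^ 2 + 1) := ⟨j, hj, rfl⟩

/-- **The bump–dip sequence has no mean value**: at `X = 2^{j²+1}` the Cesàro mean is `≥ 1/2`,
and nothing is added on the dip block, so the mean is halved at `X = 2^{j²+2}`. [folklore] -/
theorem not_hasMeanValue_seq (δ : ℝ) : ¬ HasMeanValue seq δ := by
  intro h
  change Tendsto (fun X : ℕ => psum seq X / X) atTop (𝓝 δ) at h
  set e : ℕ → ℕ := fun m => (m + 1) ^ 2 + 1 with he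
  have he_ge : ∀ m, m ≤ e m := fun m => by
    simp only [he]; nlinarith
  have hlin : Tendsto e atTop atTop :=
    tendsto_atTop_atTop.2 fun b => ⟨b, fun m hm => le_trans hm (he_ge m)⟩
  have hlin' : Tendsto (fun m => e m + 1) atTop atTop :=
    tendsto_atTop_atTop.2 fun b => ⟨b, fun m hm => le_trans hm ((he_ge m).trans (Nat.le_succ _))⟩
  have hpow : Tendsto (fun n : ℕ => 2 ^ n) atTop atTop :=
    tendsto_pow_atTop_atTop_of_one_lt one_lt_two
  have hX : Tendsto (fun m : ℕ => 2 ^ e m) atTop atTop := hpow.comp hlin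
  have hY : Tendsto (fun m : ℕ => 2 ^ (e m + 1)) atTop atTop := hpow.comp hlin'
  have h1 : Tendsto (fun m : ℕ => psum seq (2 ^ e m) / ((2 ^ e m : ℕ) : ℝ)) atTop (𝓝 δ) :=
    h.comp hX
  have h2 : Tendsto (fun m : ℕ => psum seq (2 ^ (e m + 1)) / ((2 ^ (e m + 1) : ℕ) : ℝ))
      atTop (𝓝 δ) := h.comp hY
  have hdip : ∀ m : ℕ, IsDip (e m) := fun m => isDip_sq_add_one (m + 1) (by omega)
  have hbump : ∀ m : ℕ, IsBump ((m + 1) ^ 2) := fun m => isBump_sq (m + 1) (by omega)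
  have hrel : ∀ m : ℕ, psum seq (2 ^ (e m + 1)) / ((2 ^ (e m + 1) : ℕ) : ℝ) =
      (psum seq (2 ^ e m) / ((2 ^ e m : ℕ) : ℝ)) / 2 := by
    intro m
    rw [psum_seq_pow_succ, coef_of_isDip (hdip m)]
    push_cast
    ring
  have hge : ∀ m : ℕ, (1 : ℝ) / 2 ≤ psum seq (2 ^ e m) / ((2 ^ e m : ℕ) : ℝ) := by
    intro m
    have hrec : psum seq (2 ^ e m) = psum seq (2 ^ ((m + 1) ^ 2)) + (2 : ℝ) ^ ((m + 1) ^ 2) := by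
      simp only [he]
      rw [psum_seq_pow_succ, coef_of_isBump (hbump m), one_mul]
    have hnn := psum_seq_nonneg (2 ^ ((m + 1) ^ 2))
    rw [hrec, le_div_iff₀ (by positivity)]
    push_cast
    have : (2 : ℝ) ^ e m = 2 * 2 ^ ((m + 1) ^ 2) := by simp only [he]; ring
    rw [this]
    linarith
  have hδ : (1 : ℝ) / 2 ≤ δ := ge_of_tendsto' h1 hge
  have h3 : Tendsto (fun m : ℕ => (psum seq (2 ^ e m) / ((2 ^ e m : ℕ) : ℝ)) / 2)
      atTop (𝓝 (δ / 2)) := h1.div_const 2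
  have h2' : Tendsto (fun m : ℕ => (psum seq (2 ^ e m) / ((2 ^ e m : ℕ) : ℝ)) / 2)
      atTop (𝓝 δ) := h2.congr' (Eventually.of_forall fun m => hrel m)
  have := tendsto_nhds_unique h2' h3
  linarith

/-! ### The logarithmic sums: bounded discrepancy about `1/2` -/

/-- `L(X) = ∑_{n ≤ X} seq(n)/n`. [folklore] -/
def lsum (X : ℕ) : ℝ := ∑ n ∈ Icc 1 X, seq n / n

/-- `L(2^K) = 1/2 + ∑_{k < K} coef(k) h_k`. [folklore] -/
lemma lsum_pow (K : ℕ) : lsum (2 ^ K) = 1 / 2 + ∑ k ∈ range K, coef k * blockLog k := by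
  induction K with
  | zero => simp [lsum, seq_one]
  | succ K ih =>
    unfold lsum at ih ⊢
    rw [sum_Icc_one_pow_succ, ih, sum_block_seq_div, Finset.sum_range_succ]
    ring

open Classical in
/-- The signed sum of block deviations `∑_{k < K} (coef k - 1/2)` is `1/2` right after a bump and
`0` otherwise (dips follow bumps immediately). [folklore] -/
lemma sum_range_coef_sub_half (K : ℕ) :
    ∑ k ∈ range K, (coef k - 1 / 2) = if 1 ≤ K ∧ IsBump (K - 1) then 1 / 2 else 0 := by
  induction K with
  | zero => simp
  | succ K ih =>
    rw [Finset.sum_range_succ, ih]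
    simp only [Nat.add_sub_cancel]
    by_cases hb : IsBump K
    · have h1 : ¬ (1 ≤ K ∧ IsBump (K - 1)) := fun h => hb.not_isBump_pred h.2
      rw [if_neg h1, if_pos ⟨by omega, hb⟩, coef_of_isBump hb]
      norm_num
    · by_cases hd : IsDip K
      · have h1 : 1 ≤ K ∧ IsBump (K - 1) := isDip_iff.1 hd
        rw [if_pos h1, if_neg (fun h => hb h.2), coef_of_isDip hd]
        norm_num
      · have h1 : ¬ (1 ≤ K ∧ IsBump (K - 1)) := fun h => hd (isDip_iff.2 h)
        rw [if_neg h1, if_neg (fun h => hb h.2), coef_of_not hb hd]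
        norm_num

/-- `∑_{k < K} (coef k - 1/2) ∈ [0, 1/2]`. [folklore] -/
lemma sum_range_coef_sub_half_mem (K : ℕ) :
    ∑ k ∈ range K, (coef k - 1 / 2) ∈ Set.Icc (0 : ℝ) (1 / 2) := by
  rw [sum_range_coef_sub_half]
  split_ifs <;> norm_num

/-- `|L(2^K) - (K/2) log 2| ≤ 2`. [folklore] -/
lemma abs_lsum_pow_sub_le (K : ℕ) : |lsum (2 ^ K) - (K : ℝ) / 2 * Real.log 2| ≤ 2 := by
  rw [lsum_pow]
  have hl2 : Real.log 2 ≤ 1 := by have := Real.log_two_lt_d9; linarith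
  have hl0 : 0 ≤ Real.log 2 := Real.log_nonneg (by norm_num)
  -- decomposition: coef k * h k - (1/2) log 2 = coef k * (h k - log 2) + (coef k - 1/2) * log 2
  have hdec : ∑ k ∈ range K, coef k * blockLog k - (K : ℝ) / 2 * Real.log 2 =
      ∑ k ∈ range K, coef k * (blockLog k - Real.log 2) +
        (∑ k ∈ range K, (coef k - 1 / 2)) * Real.log 2 := by
    rw [Finset.sum_mul, ← Finset.sum_add_distrib]
    have : (K : ℝ) / 2 * Real.log 2 = ∑ k ∈ range K, (1 / 2) * Real.log 2 := by
      rw [Finset.sum_const, Finset.card_range, nsmul_eq_mul]; ring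
    rw [this, ← Finset.sum_sub_distrib]
    refine Finset.sum_congr rfl fun k _ => ?_
    ring
  have h1 : |∑ k ∈ range K, coef k * (blockLog k - Real.log 2)| ≤ 1 := by
    refine (Finset.abs_sum_le_sum_abs _ _).trans ?_
    have h2 : ∀ k ∈ range K, |coef k * (blockLog k - Real.log 2)| ≤ (1 / 2) ^ (k + 1) := by
      intro k _
      rw [abs_mul, abs_of_nonneg (coef_nonneg k)]
      have hb : |blockLog k - Real.log 2| ≤ (1 / 2) ^ (k + 1) := by
        rw [abs_le]
        constructor
        · have := le_blockLog k
          rw [one_div_pow]; linarith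
        · have := blockLog_le k
          have : (0 : ℝ) ≤ (1 / 2) ^ (k + 1) := by positivity
          linarith
      calc coef k * |blockLog k - Real.log 2| ≤ 1 * |blockLog k - Real.log 2| :=
            mul_le_mul_of_nonneg_right (coef_le_one k) (abs_nonneg _)
        _ ≤ (1 / 2) ^ (k + 1) := by rw [one_mul]; exact hb
    refine (Finset.sum_le_sum h2).trans ?_
    calc ∑ k ∈ range K, ((1 : ℝ) / 2) ^ (k + 1)
        = (1 / 2) * ∑ k ∈ range K, ((1 : ℝ) / 2) ^ k := by
          rw [Finset.mul_sum]; refine Finset.sum_congr rfl fun k _ => ?_; ring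
      _ ≤ (1 / 2) * 2 := by
          gcongr
          exact sum_geometric_two_le K
      _ = 1 := by norm_num
  have h3 := sum_range_coef_sub_half_mem K
  have h4 : 0 ≤ (∑ k ∈ range K, (coef k - 1 / 2)) * Real.log 2 := mul_nonneg h3.1 hl0
  have h5 : (∑ k ∈ range K, (coef k - 1 / 2)) * Real.log 2 ≤ 1 / 2 := by
    calc (∑ k ∈ range K, (coef k - 1 / 2)) * Real.log 2 ≤ (1 / 2) * 1 :=
          mul_le_mul h3.2 hl2 hl0 (by norm_num)
      _ = 1 / 2 := by norm_num
  rw [abs_le] at h1 ⊢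
  constructor
  · have : 1 / 2 + ∑ k ∈ range K, coef k * blockLog k - (K : ℝ) / 2 * Real.log 2 =
        1 / 2 + (∑ k ∈ range K, coef k * blockLog k - (K : ℝ) / 2 * Real.log 2) := by ring
    rw [this, hdec]; linarith
  · have : 1 / 2 + ∑ k ∈ range K, coef k * blockLog k - (K : ℝ) / 2 * Real.log 2 =
        1 / 2 + (∑ k ∈ range K, coef k * blockLog k - (K : ℝ) / 2 * Real.log 2) := by ring
    rw [this, hdec]; linarith

/-- `L` is monotone (`seq ≥ 0`). [folklore] -/
lemma lsum_mono : Monotone lsum := by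
  intro X Y hXY
  unfold lsum
  refine Finset.sum_le_sum_of_subset_of_nonneg (Finset.Icc_subset_Icc le_rfl hXY) ?_
  intro n _ _
  exact div_nonneg (seq_nonneg n) (Nat.cast_nonneg n)

/-- `|L(X) - (log X)/2| ≤ 3` for all `X ≥ 1`. [folklore] -/
lemma abs_lsum_sub_half_log_le {X : ℕ} (hX : 1 ≤ X) : |lsum X - Real.log X / 2| ≤ 3 := by
  set K := Nat.log 2 X with hK
  have hX0 : X ≠ 0 := by omega
  have h1 : 2 ^ K ≤ X := Nat.pow_log_le_self 2 hX0
  have h2 : X < 2 ^ (K + 1) := Nat.lt_pow_succ_log_self (by norm_num) X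
  have hlo := lsum_mono h1
  have hhi := lsum_mono h2.le
  have eK := abs_lsum_pow_sub_le K
  have eK1 := abs_lsum_pow_sub_le (K + 1)
  rw [abs_le] at eK eK1 ⊢
  have hl2 : 0 < Real.log 2 := Real.log_pos (by norm_num)
  have hlogX_lo : (K : ℝ) * Real.log 2 ≤ Real.log X := by
    rw [← Real.log_pow]
    exact Real.log_le_log (by positivity) (by exact_mod_cast h1)
  have hlogX_hi : Real.log X ≤ ((K : ℝ) + 1) * Real.log 2 := by
    rw [← Nat.cast_add_one, ← Real.log_pow]
    exact Real.log_le_log (by exact_mod_cast (by omega : 0 < X)) (by exact_mod_cast h2.le)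
  have hl2' : Real.log 2 ≤ 1 := by have := Real.log_two_lt_d9; linarith
  push_cast at eK1
  constructor <;> nlinarith

/-- **The bump–dip sequence has bounded logarithmic discrepancy about `1/2`.** [folklore] -/
theorem abs_logSum_seq_sub_le {X : ℕ} (hX : 1 ≤ X) :
    |∑ n ∈ Icc 1 X, seq n / n - 1 / 2 * Real.log X| ≤ 3 := by
  have h := abs_lsum_sub_half_log_le hX
  have : ∑ n ∈ Icc 1 X, seq n / n - 1 / 2 * Real.log X = lsum X - Real.log X / 2 := by
    unfold lsum; ring
  rw [this]; exact h

end BumpDip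

end Literature.Barriers.Parity

namespace Literature.Barriers.Parity

/-! ## Exceptional sets of scales: logarithmic Banach density zero -/

open Classical in
/-- The logarithmic mass of `T ⊆ ℕ` in the window `[X/ω, X]`:
`∑_{X/ω ≤ n ≤ X, n ∈ T} 1/n` (only `n ≥ 1` count).
[cite: TaoTeravainen2019AlmostAllScales, Corollary 1.8 (i)] -/
def windowMass (T : Set ℕ) (ω : ℝ) (X : ℕ) : ℝ :=
  ∑ n ∈ (Icc 1 X).filter (fun n : ℕ => (X : ℝ) ≤ ω * (n : ℝ) ∧ n ∈ T), (1 : ℝ) / (n : ℝ)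

/-- `T ⊆ ℕ` has **logarithmic Banach density zero** (Tao–Teräväinen (1.6), up to the harmless
normalisation `∑_{X/ω ≤ n ≤ X} 1/n ∼ log ω`):
`lim_{ω → ∞} sup_{X ≥ ω} (1/log ω) ∑_{X/ω ≤ n ≤ X, n ∈ T} 1/n = 0`.
[cite: TaoTeravainen2019AlmostAllScales, Corollary 1.8 (i)] -/
def HasLogBanachDensityZero (T : Set ℕ) : Prop :=
  ∀ δ : ℝ, 0 < δ → ∃ ω₀ : ℝ, ∀ ω : ℝ, ω₀ ≤ ω → ∀ X : ℕ, ω ≤ X →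
    windowMass T ω X ≤ δ * Real.log ω

/-- The window mass is monotone in the set (only elements `≥ 1` matter). [folklore] -/
lemma windowMass_mono {T T' : Set ℕ} (h : ∀ n, 1 ≤ n → n ∈ T → n ∈ T') (ω : ℝ) (X : ℕ) :
    windowMass T ω X ≤ windowMass T' ω X := by
  classical
  unfold windowMass
  refine Finset.sum_le_sum_of_subset_of_nonneg (fun n hn => ?_) (fun n _ _ => by positivity)
  simp only [Finset.mem_filter, Finset.mem_Icc] at hn ⊢
  exact ⟨hn.1, hn.2.1, h n hn.1.1 hn.2.2⟩

/-- Subsets (up to the element `0`) of a log-Banach-null set are log-Banach-null. [folklore] -/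
lemma HasLogBanachDensityZero.mono {T T' : Set ℕ} (h' : HasLogBanachDensityZero T')
    (h : ∀ n, 1 ≤ n → n ∈ T → n ∈ T') : HasLogBanachDensityZero T := by
  intro δ hδ
  obtain ⟨ω₀, hω₀⟩ := h' δ hδ
  exact ⟨ω₀, fun ω hω X hX => (windowMass_mono h ω X).trans (hω₀ ω hω X hX)⟩

/-- The window mass is at most the full logarithmic mass `∑_{n ≤ X, n ∈ T} 1/n`, and that is at
most `∑_{n ∈ F} 1/n` for any finite `F ⊇ T ∩ [1, ∞)`. [folklore] -/
lemma windowMass_le_sum_of_subset {T : Set ℕ} {F : Finset ℕ} (h : ∀ n, 1 ≤ n → n ∈ T → n ∈ F)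
    (ω : ℝ) (X : ℕ) : windowMass T ω X ≤ ∑ n ∈ F, (1 : ℝ) / (n : ℝ) := by
  classical
  unfold windowMass
  refine Finset.sum_le_sum_of_subset_of_nonneg (fun n hn => ?_) (fun n _ _ => by positivity)
  simp only [Finset.mem_filter, Finset.mem_Icc] at hn
  exact h n hn.1.1 hn.2.2

/-- A set with no elements `≥ N` (other than possibly `0`) has logarithmic Banach density zero.
[folklore] -/
lemma hasLogBanachDensityZero_of_bounded {T : Set ℕ} {N : ℕ} (h : ∀ n, 1 ≤ n → n ∈ T → n < N) :
    HasLogBanachDensityZero T := by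
  intro δ hδ
  set H : ℝ := ∑ n ∈ range N, (1 : ℝ) / (n : ℝ) with hH
  have hH0 : 0 ≤ H := Finset.sum_nonneg fun n _ => by positivity
  refine ⟨Real.exp (H / δ), fun ω hω X _ => ?_⟩
  have hω1 : 0 < ω := lt_of_lt_of_le (Real.exp_pos _) hω
  have hlog : H / δ ≤ Real.log ω := by
    rw [← Real.log_exp (H / δ)]
    exact Real.log_le_log (Real.exp_pos _) hω
  calc windowMass T ω X ≤ H :=
        windowMass_le_sum_of_subset (fun n hn hT => Finset.mem_range.2 (h n hn hT)) ω X
    _ = δ * (H / δ) := by field_simp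
    _ ≤ δ * Real.log ω := mul_le_mul_of_nonneg_left hlog hδ.le

/-- **`a` has mean value `α` at almost all scales** (the shape of Tao–Teräväinen, Corollary 1.13 (i)):
for every `ε > 0` the exceptional scales `{X : |𝔼_{n ≤ X} a - α| ≥ ε}` have logarithmic Banach
density zero. [cite: TaoTeravainen2019AlmostAllScales, Corollary 1.13 (i)] -/
def HasMeanValueAAS (a : ℕ → ℝ) (α : ℝ) : Prop :=
  ∀ ε : ℝ, 0 < ε → HasLogBanachDensityZero {X | ε ≤ |cesaroMean a X - α|}

/-- Sanity: a genuine mean value is a mean value at almost all scales (the exceptional sets are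
finite). [folklore] -/
theorem HasMeanValue.hasMeanValueAAS {a : ℕ → ℝ} {α : ℝ} (h : HasMeanValue a α) :
    HasMeanValueAAS a α := by
  intro ε hε
  rw [HasMeanValue, Metric.tendsto_atTop] at h
  obtain ⟨N, hN⟩ := h ε hε
  refine hasLogBanachDensityZero_of_bounded (N := N) fun n _ hn => ?_
  by_contra hlt
  rw [not_lt] at hlt
  have := hN n hlt
  rw [Real.dist_eq] at this
  exact absurd hn (not_le.2 this)

/-- **The almost-all-scales-to-mean transfer schema** on a class `𝒞`: every `a ∈ 𝒞` with bounded
logarithmic discrepancy about `α` AND mean value `α` at almost all scales has mean value `α`.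
[cite: TaoTeravainen2019AlmostAllScales, §1 (p. 7) and Remark 1.11] -/
def AAScalesToMeanTransfer (𝒞 : Set (ℕ → ℝ)) : Prop :=
  ∀ a ∈ 𝒞, ∀ α : ℝ, HasBoundedLogDiscrepancy a α → HasMeanValueAAS a α → HasMeanValue a α

/-- Monotonicity in the class. [folklore] -/
theorem AAScalesToMeanTransfer.mono {𝒞 𝒟 : Set (ℕ → ℝ)} (h : AAScalesToMeanTransfer 𝒟)
    (hsub : 𝒞 ⊆ 𝒟) : AAScalesToMeanTransfer 𝒞 :=
  fun a ha α h1 h2 => h a (hsub ha) α h1 h2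

/-- Window-to-mean transfer implies the almost-all-scales schema (the latter has more hypotheses).
[folklore] -/
theorem WindowToMeanTransfer.aaScalesToMeanTransfer {𝒞 : Set (ℕ → ℝ)} (h : WindowToMeanTransfer 𝒞) :
    AAScalesToMeanTransfer 𝒞 :=
  fun a ha α h1 _ => h a ha α h1

/-! ### Elementary summation lemmas -/

/-- Sums of a non-negative function over a `biUnion` are at most the double sum. [folklore] -/
lemma sum_biUnion_le_sum_sum_of_nonneg {ι : Type*} (S : Finset ι) (B : ι → Finset ℕ) {f : ℕ → ℝ}
    (hf : ∀ n, 0 ≤ f n) : ∑ n ∈ S.biUnion B, f n ≤ ∑ i ∈ S, ∑ n ∈ B i, f n := by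
  classical
  induction S using Finset.induction_on with
  | empty => simp
  | insert i S hi ih =>
    rw [Finset.biUnion_insert, Finset.sum_insert hi]
    have h1 := Finset.sum_union_inter (s₁ := B i) (s₂ := S.biUnion B) (f := f)
    have h2 : 0 ≤ ∑ n ∈ B i ∩ S.biUnion B, f n := Finset.sum_nonneg fun n _ => hf n
    linarith

/-- `∑_{A < n ≤ B} 1/n ≤ 1 + log B - log A` for `1 ≤ A ≤ B`. [folklore] -/
lemma sum_Ioc_one_div_le_log {A B : ℕ} (hA : 1 ≤ A) (hAB : A ≤ B) :
    ∑ n ∈ Ioc A B, (1 : ℝ) / n ≤ 1 + Real.log B - Real.log A := by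
  have hsplit := sum_Icc_one_eq_add_sum_Ioc (fun n : ℕ => (1 : ℝ) / n) hAB
  have hHB : ∑ n ∈ Icc 1 B, (1 : ℝ) / n = (harmonic B : ℝ) := by
    rw [harmonic_eq_sum_Icc]; push_cast; simp [one_div]
  have hHA : ∑ n ∈ Icc 1 A, (1 : ℝ) / n = (harmonic A : ℝ) := by
    rw [harmonic_eq_sum_Icc]; push_cast; simp [one_div]
  have h1 : (harmonic B : ℝ) ≤ 1 + Real.log B := harmonic_le_one_add_log B
  have h2 : Real.log A ≤ (harmonic A : ℝ) :=
    (Real.log_le_log (by exact_mod_cast hA) (by push_cast; linarith)).trans (log_add_one_le_harmonic A)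
  linarith

namespace BumpDip

/-! ### Where the Cesàro mean of the bump–dip sequence can be far from `1/2` -/

open Classical in
/-- If every bump/dip element `≤ X` is `≤ M`, then `|∑_{n ≤ X} seq(n) - X/2| ≤ M/2`. [folklore] -/
lemma abs_psum_seq_sub_half_le {X M : ℕ}
    (hM : ∀ n ∈ Icc 1 X, n ∈ bumpSet ∪ dipSet → n ≤ M) :
    |psum seq X - (X : ℝ) / 2| ≤ (M : ℝ) / 2 := by
  have hdev : ∀ n, |seq n - 1 / 2| ≤ (1 / 2) * (bumpSet ∪ dipSet).indicator (1 : ℕ → ℝ) n := by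
    intro n
    unfold seq
    by_cases hb : n ∈ bumpSet
    · rw [Set.indicator_of_mem hb, Set.indicator_of_mem (Set.mem_union_left _ hb)]
      by_cases hd : n ∈ dipSet
      · rw [Set.indicator_of_mem hd]; norm_num
      · rw [Set.indicator_of_notMem hd]; norm_num
    · rw [Set.indicator_of_notMem hb]
      by_cases hd : n ∈ dipSet
      · rw [Set.indicator_of_mem hd, Set.indicator_of_mem (Set.mem_union_right _ hd)]; norm_num
      · rw [Set.indicator_of_notMem hd,
          Set.indicator_of_notMem (fun h => h.elim hb hd)]; norm_num
  have hsum : psum seq X - (X : ℝ) / 2 = ∑ n ∈ Icc 1 X, (seq n - 1 / 2) := by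
    rw [Finset.sum_sub_distrib, Finset.sum_const, Nat.card_Icc, nsmul_eq_mul]
    unfold psum
    push_cast
    ring
  rw [hsum]
  refine (Finset.abs_sum_le_sum_abs _ _).trans ?_
  refine (Finset.sum_le_sum fun n _ => hdev n).trans ?_
  rw [← Finset.mul_sum]
  have hind : ∑ n ∈ Icc 1 X, (bumpSet ∪ dipSet).indicator (1 : ℕ → ℝ) n
      = (((Icc 1 X).filter (fun n => n ∈ bumpSet ∪ dipSet)).card : ℝ) := by
    rw [Finset.card_eq_sum_ones, Nat.cast_sum, Finset.sum_filter]
    refine Finset.sum_congr rfl fun n _ => ?_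
    by_cases h : n ∈ bumpSet ∪ dipSet <;> simp [h]
  have hcard : ((Icc 1 X).filter (fun n => n ∈ bumpSet ∪ dipSet)).card ≤ M := by
    calc ((Icc 1 X).filter (fun n => n ∈ bumpSet ∪ dipSet)).card ≤ (Icc 1 M).card := by
          refine Finset.card_le_card fun n hn => ?_
          rw [Finset.mem_filter] at hn
          rw [Finset.mem_Icc]
          exact ⟨(Finset.mem_Icc.1 hn.1).1, hM n hn.1 hn.2⟩
      _ = M := by simp
  rw [hind]
  have : (((Icc 1 X).filter (fun n => n ∈ bumpSet ∪ dipSet)).card : ℝ) ≤ M := by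
    exact_mod_cast hcard
  linarith

/-- The tail set `T_ε = ⋃_{j ≥ 1} (2^{j²}, 2^{j²+1}/ε]` that contains every exceptional scale.
[folklore] -/
def excTail (ε : ℝ) : Set ℕ := {X | ∃ j, 1 ≤ j ∧ 2 ^ (j ^ 2) < X ∧ (X : ℝ) ≤ 2 ^ (j ^ 2 + 1) / ε}

open Classical in
/-- **Exceptional scales are close behind a bump**: if `|𝔼_{n ≤ X} seq - 1/2| ≥ ε` (`X ≥ 1`,
`ε > 0`) then `2^{j²} < X ≤ 2^{j²+1}/ε` for some `j ≥ 1`. [folklore] -/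
lemma mem_excTail_of_le_abs {ε : ℝ} (hε : 0 < ε) {X : ℕ} (hX : 1 ≤ X)
    (hbad : ε ≤ |cesaroMean seq X - 1 / 2|) : X ∈ excTail ε := by
  have hXr : (0 : ℝ) < X := by exact_mod_cast hX
  have hcm : cesaroMean seq X - 1 / 2 = (psum seq X - (X : ℝ) / 2) / X := by
    rw [cesaroMean_eq]; field_simp
  set S := (Icc 1 X).filter (fun n => n ∈ bumpSet ∪ dipSet) with hS
  by_cases hne : S.Nonempty
  · set n₀ := S.max' hne with hn₀
    have hn₀S : n₀ ∈ S := Finset.max'_mem S hne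
    rw [Finset.mem_filter, Finset.mem_Icc] at hn₀S
    obtain ⟨⟨-, hn₀X⟩, hn₀BD⟩ := hn₀S
    -- the block of n₀
    obtain ⟨k, hk, hk1, hk2⟩ : ∃ k, (IsBump k ∨ IsDip k) ∧ 2 ^ k < n₀ ∧ n₀ ≤ 2 ^ (k + 1) := by
      rcases hn₀BD with ⟨k, hk, h1, h2⟩ | ⟨k, hk, h1, h2⟩
      · exact ⟨k, Or.inl hk, h1, h2⟩
      · exact ⟨k, Or.inr hk, h1, h2⟩
    have hM : ∀ n ∈ Icc 1 X, n ∈ bumpSet ∪ dipSet → n ≤ 2 ^ (k + 1) := by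
      intro n hn hBD
      have hnS : n ∈ S := Finset.mem_filter.2 ⟨hn, hBD⟩
      exact (Finset.le_max' S n hnS).trans hk2
    have hdev := abs_psum_seq_sub_half_le hM
    have hkX : ε * X ≤ (2 : ℝ) ^ k := by
      have h1 : ε ≤ |psum seq X - (X : ℝ) / 2| / X := by
        rw [hcm, abs_div, Nat.abs_cast] at hbad; exact hbad
      rw [le_div_iff₀ hXr] at h1
      refine h1.trans (hdev.trans (le_of_eq ?_))
      push_cast
      rw [pow_succ]
      ring
    have hXle : (X : ℝ) ≤ 2 ^ k / ε := by
      rw [le_div_iff₀ hε]; linarith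
    have hkltX : 2 ^ k < X := lt_of_lt_of_le hk1 hn₀X
    rcases hk with ⟨j, hj, rfl⟩ | ⟨j, hj, rfl⟩
    · refine ⟨j, hj, hkltX, hXle.trans ?_⟩
      have : (2 : ℝ) ^ (j ^ 2) ≤ 2 ^ (j ^ 2 + 1) := pow_le_pow_right₀ (by norm_num) (by omega)
      exact div_le_div_of_nonneg_right this hε.le
    · refine ⟨j, hj, lt_trans ?_ hkltX, hXle⟩
      exact Nat.pow_lt_pow_right (by norm_num) (Nat.lt_succ_self _)
  · -- no bump/dip element ≤ X: the mean is exactly 1/2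
    have hM : ∀ n ∈ Icc 1 X, n ∈ bumpSet ∪ dipSet → n ≤ 0 := by
      intro n hn hBD
      exact absurd ⟨n, Finset.mem_filter.2 ⟨hn, hBD⟩⟩ hne
    have hdev := abs_psum_seq_sub_half_le hM
    have h0 : psum seq X - (X : ℝ) / 2 = 0 := by
      have : |psum seq X - (X : ℝ) / 2| ≤ 0 := by simpa using hdev
      exact abs_eq_zero.1 (le_antisymm this (abs_nonneg _))
    rw [hcm, h0, zero_div, abs_zero] at hbad
    exact absurd hbad (not_le.2 hε)

/-! ### The tail set has logarithmic Banach density zero -/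

open Classical in
/-- Log-mass of one tail interval: `∑_{2^{j²} < n ≤ 2^{j²+1}/ε, n ≤ X} 1/n ≤ 1 + log(2/ε)` (`0 < ε ≤ 1`).
[folklore] -/
lemma tailPiece_le {ε : ℝ} (hε : 0 < ε) (hε1 : ε ≤ 1) (j X : ℕ) :
    ∑ n ∈ (Icc 1 X).filter (fun n : ℕ => 2 ^ (j ^ 2) < n ∧ (n : ℝ) ≤ 2 ^ (j ^ 2 + 1) / ε),
        (1 : ℝ) / (n : ℝ) ≤ 1 + Real.log (2 / ε) := by
  set A : ℕ := 2 ^ (j ^ 2) with hA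
  set Bn : ℕ := ⌊(2 : ℝ) ^ (j ^ 2 + 1) / ε⌋₊ with hBn
  have hA1 : 1 ≤ A := Nat.one_le_two_pow
  have hsub : (Icc 1 X).filter (fun n : ℕ => 2 ^ (j ^ 2) < n ∧ (n : ℝ) ≤ 2 ^ (j ^ 2 + 1) / ε)
      ⊆ Ioc A Bn := by
    intro n hn
    rw [Finset.mem_filter] at hn
    rw [Finset.mem_Ioc]
    exact ⟨hn.2.1, Nat.le_floor hn.2.2⟩
  have hle2 : 0 ≤ Real.log (2 / ε) := Real.log_nonneg (by rw [le_div_iff₀ hε]; linarith)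
  refine (Finset.sum_le_sum_of_subset_of_nonneg hsub (fun n _ _ => by positivity)).trans ?_
  rcases lt_or_ge Bn A with hlt | hAB
  · rw [Finset.Ioc_eq_empty (not_lt.2 hlt.le), Finset.sum_empty]
    linarith
  · refine (sum_Ioc_one_div_le_log hA1 hAB).trans ?_
    have hBpos : (0 : ℝ) < Bn := by exact_mod_cast (lt_of_lt_of_le hA1 hAB)
    have hBle : (Bn : ℝ) ≤ 2 ^ (j ^ 2 + 1) / ε := Nat.floor_le (by positivity)
    have h1 : Real.log Bn ≤ Real.log (2 ^ (j ^ 2 + 1) / ε) := Real.log_le_log hBpos hBle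
    have h2 : Real.log ((2 : ℝ) ^ (j ^ 2 + 1) / ε) = Real.log A + Real.log (2 / ε) := by
      have e : (2 : ℝ) ^ (j ^ 2 + 1) / ε = (A : ℝ) * (2 / ε) := by
        rw [hA]; push_cast; rw [pow_succ]; ring
      rw [e, Real.log_mul (by positivity) (by positivity)]
    linarith

/-- `(j₂ - j₁)² ≤ j₂² - j₁²` in `ℕ`. [folklore] -/
lemma sq_sub_le_sq_sub_sq {j₁ j₂ : ℕ} (h : j₁ ≤ j₂) : (j₂ - j₁) ^ 2 ≤ j₂ ^ 2 - j₁ ^ 2 := by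
  obtain ⟨d, rfl⟩ := Nat.exists_eq_add_of_le h
  have : (j₁ + d) ^ 2 = j₁ ^ 2 + (2 * j₁ * d + d ^ 2) := by ring
  rw [Nat.add_sub_cancel_left, this, Nat.add_sub_cancel_left]
  nlinarith

open Classical in
/-- **Window estimate.** For `0 < ε ≤ 1`, `ω ≥ 1` and every `X`, the window `[X/ω, X]` meets the
tail set in log-mass `≤ (d + 1)(1 + log(2/ε))` for some `d ∈ ℕ` with `d² ≤ log₂ ⌊2ω/ε⌋`: the
indices `j` whose tail interval meets the window satisfy `εX/(2ω) ≤ 2^{j²} < X`. [folklore] -/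
lemma windowMass_excTail_le {ε : ℝ} (hε : 0 < ε) (hε1 : ε ≤ 1) {ω : ℝ} (hω : 1 ≤ ω) (X : ℕ) :
    ∃ d : ℕ, d ^ 2 ≤ Nat.log 2 ⌊2 * ω / ε⌋₊ ∧
      windowMass (excTail ε) ω X ≤ ((d : ℝ) + 1) * (1 + Real.log (2 / ε)) := by
  set m : ℝ := 1 + Real.log (2 / ε) with hm
  have hm0 : 0 ≤ m := by
    have : 0 ≤ Real.log (2 / ε) := Real.log_nonneg (by rw [le_div_iff₀ hε]; linarith)
    linarith
  -- indices whose tail interval can meet the window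
  set J := (range (X + 1)).filter
    (fun j : ℕ => 1 ≤ j ∧ 2 ^ (j ^ 2) < X ∧ (X : ℝ) ≤ ω * (2 ^ (j ^ 2 + 1) / ε)) with hJ
  set I : ℕ → Finset ℕ := fun j =>
    (Icc 1 X).filter (fun n : ℕ => 2 ^ (j ^ 2) < n ∧ (n : ℝ) ≤ 2 ^ (j ^ 2 + 1) / ε) with hI
  -- the window set is covered by ⋃_{j ∈ J} I j
  have hcover : (Icc 1 X).filter (fun n : ℕ => (X : ℝ) ≤ ω * (n : ℝ) ∧ n ∈ excTail ε) ⊆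
      J.biUnion I := by
    intro n hn
    rw [Finset.mem_filter, Finset.mem_Icc] at hn
    obtain ⟨⟨hn1, hnX⟩, hωn, j, hj, hjn, hnj⟩ := hn
    rw [Finset.mem_biUnion]
    refine ⟨j, ?_, ?_⟩
    · rw [hJ, Finset.mem_filter, Finset.mem_range]
      refine ⟨?_, hj, lt_of_lt_of_le hjn hnX, hωn.trans ?_⟩
      · have h1 : j ≤ j ^ 2 := Nat.le_self_pow two_ne_zero j
        have h2 : j ^ 2 < 2 ^ (j ^ 2) := Nat.lt_two_pow_self
        omega
      · exact mul_le_mul_of_nonneg_left hnj (by linarith)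
    · rw [hI, Finset.mem_filter, Finset.mem_Icc]
      exact ⟨⟨hn1, hnX⟩, hjn, hnj⟩
  have hmass : windowMass (excTail ε) ω X ≤ (J.card : ℝ) * m := by
    unfold windowMass
    calc ∑ n ∈ (Icc 1 X).filter (fun n : ℕ => (X : ℝ) ≤ ω * (n : ℝ) ∧ n ∈ excTail ε),
          (1 : ℝ) / (n : ℝ)
        ≤ ∑ n ∈ J.biUnion I, (1 : ℝ) / (n : ℝ) :=
          Finset.sum_le_sum_of_subset_of_nonneg hcover (fun n _ _ => by positivity)
      _ ≤ ∑ j ∈ J, ∑ n ∈ I j, (1 : ℝ) / (n : ℝ) :=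
          sum_biUnion_le_sum_sum_of_nonneg J I (fun n => by positivity)
      _ ≤ ∑ j ∈ J, m := Finset.sum_le_sum fun j _ => tailPiece_le hε hε1 j X
      _ = (J.card : ℝ) * m := by rw [Finset.sum_const, nsmul_eq_mul]
  by_cases hne : J.Nonempty
  · set j₁ := J.min' hne with hj₁
    set j₂ := J.max' hne with hj₂
    have hj₁J : j₁ ∈ J := Finset.min'_mem J hne
    have hj₂J : j₂ ∈ J := Finset.max'_mem J hne
    have hj₁₂ : j₁ ≤ j₂ := Finset.min'_le J j₂ hj₂J
    have hJsub : J ⊆ Icc j₁ j₂ := fun j hj =>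
      Finset.mem_Icc.2 ⟨Finset.min'_le J j hj, Finset.le_max' J j hj⟩
    have hcardJ : J.card ≤ j₂ - j₁ + 1 := by
      calc J.card ≤ (Icc j₁ j₂).card := Finset.card_le_card hJsub
        _ = j₂ + 1 - j₁ := Nat.card_Icc j₁ j₂
        _ = j₂ - j₁ + 1 := by omega
    -- the gap bound: 2^{j₂² - j₁²} < 2ω/ε
    rw [hJ, Finset.mem_filter] at hj₁J hj₂J
    obtain ⟨-, -, -, hXle⟩ := hj₁J
    obtain ⟨-, -, hltX, -⟩ := hj₂J
    have hsq : j₁ ^ 2 ≤ j₂ ^ 2 := Nat.pow_le_pow_left hj₁₂ 2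
    have hgapR : ((2 ^ (j₂ ^ 2 - j₁ ^ 2) : ℕ) : ℝ) ≤ 2 * ω / ε := by
      have h1 : ((2 : ℝ) ^ (j₂ ^ 2)) < ω * (2 ^ (j₁ ^ 2 + 1) / ε) :=
        lt_of_lt_of_le (by exact_mod_cast hltX) hXle
      have h2 : (2 : ℝ) ^ (j₂ ^ 2) = 2 ^ (j₂ ^ 2 - j₁ ^ 2) * 2 ^ (j₁ ^ 2) := by
        rw [← pow_add, Nat.sub_add_cancel hsq]
      have hpos : (0 : ℝ) < 2 ^ (j₁ ^ 2) := by positivity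
      have e : (2 : ℝ) ^ (j₁ ^ 2 + 1) = 2 ^ (j₁ ^ 2) * 2 := pow_succ _ _
      push_cast
      rw [h2, e] at h1
      have h3 : (2 : ℝ) ^ (j₂ ^ 2 - j₁ ^ 2) < 2 * ω / ε := by
        rw [lt_div_iff₀ hε]
        have h4 : (2 : ℝ) ^ (j₂ ^ 2 - j₁ ^ 2) * 2 ^ (j₁ ^ 2) * ε < ω * (2 ^ (j₁ ^ 2) * 2) := by
          have := mul_lt_mul_of_pos_right h1 hε
          rwa [mul_assoc ω, div_mul_cancel₀ _ hε.ne'] at this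
        nlinarith
      exact h3.le
    have hgapN : 2 ^ (j₂ ^ 2 - j₁ ^ 2) ≤ ⌊2 * ω / ε⌋₊ := Nat.le_floor hgapR
    have hlog : j₂ ^ 2 - j₁ ^ 2 ≤ Nat.log 2 ⌊2 * ω / ε⌋₊ :=
      Nat.le_log_of_pow_le (by norm_num) hgapN
    refine ⟨j₂ - j₁, (sq_sub_le_sq_sub_sq hj₁₂).trans hlog, hmass.trans ?_⟩
    refine mul_le_mul_of_nonneg_right ?_ hm0
    exact_mod_cast hcardJ
  · refine ⟨0, Nat.zero_le _, hmass.trans ?_⟩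
    rw [Finset.not_nonempty_iff_eq_empty.1 hne]
    simp [hm0]

/-- **The tail set has logarithmic Banach density zero** (`0 < ε ≤ 1`): a window of multiplicative
width `ω` meets `O(√(log ω))` tail intervals, each of log-mass `O_ε(1)`. [folklore] -/
theorem hasLogBanachDensityZero_excTail {ε : ℝ} (hε : 0 < ε) (hε1 : ε ≤ 1) :
    HasLogBanachDensityZero (excTail ε) := by
  intro δ hδ
  set m : ℝ := 1 + Real.log (2 / ε) with hm
  have hm1 : 1 ≤ m := by
    have : 0 ≤ Real.log (2 / ε) := Real.log_nonneg (by rw [le_div_iff₀ hε]; linarith)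
    linarith
  set c₁ : ℝ := 2 + 2 * |Real.log ε| with hc₁
  set R₀ : ℝ := δ * c₁ / 4 + m ^ 2 / δ + m with hR₀
  have hR₀nn : 0 ≤ R₀ := by positivity
  refine ⟨Real.exp (2 * R₀ / δ), fun ω hω X _ => ?_⟩
  have hω1 : 1 ≤ ω := le_trans (Real.one_le_exp (by positivity)) hω
  have hL : 2 * R₀ / δ ≤ Real.log ω := by
    rw [← Real.log_exp (2 * R₀ / δ)]
    exact Real.log_le_log (Real.exp_pos _) hω
  have hL0 : 0 ≤ Real.log ω := Real.log_nonneg hω1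
  obtain ⟨d, hd, hmass⟩ := windowMass_excTail_le hε hε1 hω1 X
  -- Λ = log₂ ⌊2ω/ε⌋ ≤ 2 log ω + c₁
  set y : ℕ := ⌊2 * ω / ε⌋₊ with hy
  have hΛ : ((Nat.log 2 y : ℕ) : ℝ) ≤ 2 * Real.log ω + c₁ := by
    rcases Nat.eq_zero_or_pos y with hy0 | hypos
    · rw [hy0, Nat.log_zero_right]; push_cast
      have : 0 ≤ |Real.log ε| := abs_nonneg _
      linarith
    · have h1 : ((2 ^ Nat.log 2 y : ℕ) : ℝ) ≤ y := by exact_mod_cast Nat.pow_log_le_self 2 hypos.ne'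
      have h2 : (y : ℝ) ≤ 2 * ω / ε := Nat.floor_le (by positivity)
      have h3 : (Nat.log 2 y : ℝ) * Real.log 2 ≤ Real.log (2 * ω / ε) := by
        rw [← Real.log_pow]
        refine Real.log_le_log (by positivity) ?_
        push_cast at h1
        exact h1.trans h2
      have h4 : Real.log (2 * ω / ε) = Real.log 2 + Real.log ω - Real.log ε := by
        rw [Real.log_div (by positivity) hε.ne', Real.log_mul (by norm_num) (by positivity)]
      have hl2 : (1 : ℝ) / 2 ≤ Real.log 2 := by have := Real.log_two_gt_d9; linarith
      have hl2' : Real.log 2 ≤ 1 := by have := Real.log_two_lt_d9; linarith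
      have h5 : -Real.log ε ≤ |Real.log ε| := neg_le_abs _
      have hN0 : (0 : ℝ) ≤ (Nat.log 2 y : ℕ) := Nat.cast_nonneg _
      nlinarith
  -- d ≤ via AM–GM
  have hd' : (d : ℝ) ^ 2 ≤ 2 * Real.log ω + c₁ := le_trans (by exact_mod_cast hd) hΛ
  have hdm : (d : ℝ) * m ≤ δ / 4 * (d : ℝ) ^ 2 + m ^ 2 / δ := by
    have h0 : 0 ≤ (δ * d / 2 - m) ^ 2 / δ := by positivity
    have e : (δ * d / 2 - m) ^ 2 / δ = δ / 4 * (d : ℝ) ^ 2 - d * m + m ^ 2 / δ := by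
      field_simp; ring
    linarith [e ▸ h0]
  calc windowMass (excTail ε) ω X ≤ ((d : ℝ) + 1) * m := hmass
    _ = (d : ℝ) * m + m := by ring
    _ ≤ δ / 4 * (2 * Real.log ω + c₁) + m ^ 2 / δ + m := by nlinarith
    _ = δ / 2 * Real.log ω + R₀ := by rw [hR₀]; ring
    _ ≤ δ * Real.log ω := by
        have : 2 * R₀ ≤ Real.log ω * δ := (div_le_iff₀ hδ).1 hL
        nlinarith

/-- **The bump–dip sequence has mean value `1/2` at almost all scales** (logarithmic Banach density
zero exceptional sets, the shape of Tao–Teräväinen's Corollary 1.13 (i)). [folklore] -/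
theorem hasMeanValueAAS_seq : HasMeanValueAAS seq (1 / 2) := by
  intro ε hε
  set ε' : ℝ := min ε 1 with hε'
  have hε'0 : 0 < ε' := lt_min hε one_pos
  have hε'1 : ε' ≤ 1 := min_le_right _ _
  refine (hasLogBanachDensityZero_excTail hε'0 hε'1).mono fun n hn hbad => ?_
  exact mem_excTail_of_le_abs hε'0 hn (le_trans (min_le_left _ _) hbad)

/-- The bump–dip sequence has bounded logarithmic discrepancy about `1/2`. [folklore] -/
theorem hasBoundedLogDiscrepancy_seq : HasBoundedLogDiscrepancy seq (1 / 2) :=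
  ⟨3, fun _ hX => abs_logSum_seq_sub_le hX⟩

/-- The bump–dip sequence is `[0,1]`-valued. [folklore] -/
theorem seq_mem_unitInterval : seq ∈ {a : ℕ → ℝ | ∀ n, 0 ≤ a n ∧ a n ≤ 1} :=
  fun n => ⟨seq_nonneg n, seq_le_one n⟩

end BumpDip

/-- **No transfer from everything the logarithmic methods deliver.** On `[0,1]`-valued sequences,
bounded logarithmic discrepancy (hence every windowed logarithmic statement) together with the
mean value at almost all scales (logarithmic Banach density zero exceptional sets) do NOT give a
mean value: the bump–dip sequence.
[cite: TaoTeravainen2019AlmostAllScales, §1 (p. 7) and Remark 1.11] -/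
theorem not_aaScalesToMeanTransfer_unitInterval :
    ¬ AAScalesToMeanTransfer {a : ℕ → ℝ | ∀ n, 0 ≤ a n ∧ a n ≤ 1} := fun hT =>
  BumpDip.not_hasMeanValue_seq (1 / 2)
    (hT _ BumpDip.seq_mem_unitInterval (1 / 2) BumpDip.hasBoundedLogDiscrepancy_seq
      BumpDip.hasMeanValueAAS_seq)

/-- The same on `1`-bounded sequences (the a-priori class of `λ(n)λ(n+h)`).
[cite: TaoTeravainen2019AlmostAllScales, §1 (p. 7) and Remark 1.11] -/
theorem not_aaScalesToMeanTransfer_bounded :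
    ¬ AAScalesToMeanTransfer {a : ℕ → ℝ | ∀ n, |a n| ≤ 1} := by
  intro h
  refine not_aaScalesToMeanTransfer_unitInterval (h.mono fun a ha n => ?_)
  rw [abs_le]
  exact ⟨by linarith [(ha n).1], (ha n).2⟩

/-- The same on non-negative sequences with partial sums `≤ X` (the a-priori class of
`Λ(n)Λ(n+h)/C`). [cite: TaoTeravainen2019AlmostAllScales, §1 (p. 7) and Remark 1.11] -/
theorem not_aaScalesToMeanTransfer_nonneg :
    ¬ AAScalesToMeanTransfer {a : ℕ → ℝ | (∀ n, 0 ≤ a n) ∧ ∀ X, ∑ n ∈ Icc 1 X, a n ≤ X} := by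
  intro h
  refine not_aaScalesToMeanTransfer_unitInterval (h.mono fun a ha => ⟨fun n => (ha n).1, fun X => ?_⟩)
  calc ∑ n ∈ Icc 1 X, a n ≤ ∑ n ∈ Icc 1 X, (1 : ℝ) := Finset.sum_le_sum fun n _ => (ha n).2
    _ = X := by simp

/-! ## The catalogue record -/

/-- **Logarithmic averaging barrier — scope (audit companion of `LogarithmicAveraging`, 2026-08-16)**
(Hall 1996 (0.15); Tao 2016, Theorem 1.3; Tao–Teräväinen 2019, §1, Remarks 1.10–1.11, Corollary 1.13;
Helfgott–Radziwiłł 2021, Corollaries 1.4–1.6). (i) No window-to-mean transfer on `{0,1}`-valued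
sequences: bounded logarithmic discrepancy (hence `α log ω + O(1)` on EVERY window `(x/ω, x]`) does
not give a mean value — Hall's set; (ii) no almost-all-scales-to-mean transfer on `[0,1]`-valued
sequences: bounded logarithmic discrepancy AND the mean value at almost all scales (exceptional sets
of logarithmic Banach density zero) do not give a mean value — the bump–dip sequence; (iii) the
positive side: for a bounded sequence, a good scale in every interval `[X, (1+ε)X]` (eventually, for
each `ε > 0`) gives the mean value. PROVED (`LogarithmicAveragingScope_holds`).
[cite: TaoTeravainen2019AlmostAllScales, §1 (p. 7), Remarks 1.10–1.11 and Corollary 1.13] [cite: HelfgottRadziwill2021, Corollaries 1.4–1.6]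

BARRIER (D-0021; one line per key):
technique_class: logarithmic-averaging methods, as in `LogarithmicAveraging` — the entropy-decrement argument and its descendants (expander estimates for the prime-divisibility graph included), whose printed outputs are (α) WINDOWED logarithmic correlation estimates `∑_{x/ω<n≤x} g₁(n)g₂(n+h)/n = o(log ω)` for every `ω → ∞` [cite: TaoFMP2016, Theorem 1.3] [cite: HelfgottRadziwill2021, Corollary 1.5] and (β) UNWEIGHTED estimates at ALMOST ALL scales, the exceptional scales forming a set of logarithmic (Banach) density zero [cite: TaoTeravainen2019AlmostAllScales, Corollaries 1.8, 1.13–1.14] [cite: HelfgottRadziwill2021, Corollary 1.6] — followed by any passage to ALL scales that uses of the correlation sequence only boundedness / non-negativity / `O(X)` partial sums together with (α) in its strongest form (bounded logarithmic discrepancy, `HasBoundedLogDiscrepancy`) and (β) (`HasMeanValueAAS`), i.e. any proof of `WindowToMeanTransfer 𝒞` or of `AAScalesToMeanTransfer 𝒞` for a class `𝒞` containing the `[0,1]`-valued sequences.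
blocks: (a) upgrading the binary unweighted Elliott / two-point (and odd-order) unweighted Chowla correlation statements from "almost all scales" (`∑_{n≤X} λ(n)λ(n+h) = o(X)` for `X` outside a log-Banach-null set of scales; the `k = 2` case of the Parity sub-problem's Chowla statement) to ALL scales by a soft argument: "It would of course be desirable if we could upgrade "almost all scales" to "all scales" in the above results. We do not know how to do so in general" — and no argument confined to (α), (β) and the a-priori size information can do it (`not_aaScalesToMeanTransfer_bounded`) [cite: TaoTeravainen2019AlmostAllScales, §1 (p. 7) and Corollaries 1.13–1.14]; (b) the same for the Hardy–Littlewood pair asymptotic (`d = 1, t = 2` of `Literature.NumberTheory.Sieve.GeneralizedHardyLittlewood`; crux `PairsHL` of route `TauberianTwins`): even a log-averaged asymptotic (L) with `O(1)` error on every window plus HL at almost all scales would not give HL by soft means (`not_aaScalesToMeanTransfer_nonneg`), so the route's Tauberian second input ((R) slow oscillation across `[N, N^{1+δ}]`, or (I)) is of a genuinely different kind — it is across-scale REGULARITY, which is exactly what (α)+(β) lack [cite: TaoTeravainen2019AlmostAllScales, Remark 1.11]; (c) a fortiori everything `LogarithmicAveraging` blocks (transfer from the plain logarithmic mean value), since `LogToMeanTransfer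 𝒞 → WindowToMeanTransfer 𝒞 → AAScalesToMeanTransfer 𝒞` [cite: Hall1996SetsOfMultiples, §0.3 (0.14)–(0.15)].
because: (i) Hall's set `⋃_{k odd} (2^k, 2^{k+1}]` has `|∑_{n≤X, n∈K} 1/n − (log X)/2| ≤ 3` (`hasBoundedLogDiscrepancy_hallSet`: each dyadic block carries harmonic mass `log 2 + O(2^{-k})` and every other block is in `K`) and no natural density, so (α) in its strongest form is compatible with divergent Cesàro means (`not_windowToMeanTransfer_indicator`) [cite: Hall1996SetsOfMultiples, §0.3 (0.15)]; (ii) the bump–dip sequence `BumpDip.seq` (value `1/2`; `1` on `(2^{j²}, 2^{j²+1}]`, `0` on `(2^{j²+1}, 2^{j²+2}]`, `j ≥ 1`): a bump and the following dip cancel in logarithmic mass up to `2^{-j²}` and at most one bump is unpaired below any `X` (`BumpDip.abs_logSum_seq_sub_le`: discrepancy `≤ 3`); the Cesàro mean is `≥ 1/2 + 1/4·(…) ≥ 1/2` at `X = 2^{j²+1}` and is halved on the dip, at `X = 2^{j²+2}` (`BumpDip.not_hasMeanValue_seq`); and a scale `X` with `|𝔼_{n≤X} seq − 1/2| ≥ ε`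 satisfies `2^{j²} < X ≤ 2^{j²+1}/ε` for the last bump or dip below `X` (`BumpDip.mem_excTail_of_le_abs`: all earlier bumps and dips have total size `≤ 2^{j²+1}`), while `⋃_j (2^{j²}, 2^{j²+1}/ε]` meets a window of multiplicative width `ω` in at most `d + 1` pieces with `d² ≤ log₂⌊2ω/ε⌋` (the squares are sparse), each of logarithmic mass `≤ 1 + log(2/ε)`, total `O_ε(√(log ω)) = o(log ω)` (`BumpDip.hasLogBanachDensityZero_excTail`) [folklore]; (iii) "The logarithmic density (or logarithmic Banach density) appearing in Corollaries 1.8 and 1.13 is the right density to consider in this problem" — the methods' exceptional sets are log-null, not asymptotically null [cite: TaoTeravainen2019AlmostAllScales, Remark 1.11]; (iv) inside the methods the logarithm enters through the dilation `n ↦ pn` ("note here how the logarithmic averaging allows us to leave the constraint `n ≤ x` unchanged"; Tao's identity over prime dilates "necessitates the use of logarithmic averages") and it SURVIVES the replacement of the entropy-decrement pigeonholing of the scale `H` by a genuine expander estimate at one dyadic scale: Helfgott–Radziwiłł's identity controls `(1/(N𝓛)) ∑_{p∈𝐏} ∑_{N/p<n≤2N/p} …`, an average over the scales `N/p`, `p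 ∈ 𝐏`, and needs `𝓛 = ∑_{p∈𝐏} 1/p → ∞` for its saving `O(𝓛^{-1/2})`, whence only (α) (Corollary 1.5) and (β) (Corollary 1.6) [cite: TaoFMP2016, §1 (p. 3) and §4 (p. 15)] [cite: FrantzikinakisHost2019, §1 (before Theorem 1.5)] [cite: HelfgottRadziwill2021, §1.2 and Corollaries 1.4–1.6].
evasions_known: (a) PROVED here: ACROSS-SCALE REGULARITY suffices softly — for a bounded sequence, a scale `X' ∈ [X, (1+ε)X]` with `|𝔼_{n≤X'} a − α| ≤ ε` for all large `X` (each `ε > 0`) forces `𝔼_{n≤X} a → α` (`hasMeanValue_of_goodScale_nearby`, from the log-Lipschitz bound `|𝔼_{n≤X'} a − 𝔼_{n≤X} a| ≤ 2B(X'−X)/X'`, `abs_cesaroMean_sub_le`); this is Tao–Teräväinen's remark that an exceptional set of ASYMPTOTIC density zero "would easily imply … that the unweighted correlation converges to zero without any exceptional scales", and it is the form of the Tauberian input (R) of route `TauberianTwins` [cite: TaoTeravainen2019AlmostAllScales, Remark 1.11]; (b) few sign patterns: if for every `ε > 0` there are arbitrarily large `K` with fewer than `exp(εK/log K)` Liouville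 sign patterns of length `K`, then `lim_X 𝔼_{n≤X} λ(n)λ(n+h) = 0` at ALL scales (a hypothesis expected to be vacuous) [cite: TaoTeravainen2019AlmostAllScales, Theorem 1.17]; (c) arithmetic structure outside (α)/(β): multiplicative functions pretentious at LARGE primes (`𝔻(f_j, χ_j(n)n^{it_j}; x^ε, x) ≤ ε`) have unweighted correlation bounds at EVERY scale `x ≥ 3` by pretentious/sieve methods, giving vanishing unweighted correlations of all orders for Liouville-like `(−1)^{Ω_𝒫(n)}`, `𝒫` of relative density `0`, `∑_{p∈𝒫} 1/p = ∞` — inapplicable to `λ`, `μ`, `Λ` [cite: KlurmanMangerelTeravainen2023, Theorems 2.1 and 4.1]; (d) an exceptional (Siegel) zero: unweighted Chowla and Hardy–Littlewood at the corresponding scales (catalogue `SiegelZeroDichotomyChowla`, `SiegelZeroPrimePairs`) [cite: TaoTeravainen2019AlmostAllScales, §1 (p. 7)]; (e) the evasions (a)–(c) of `LogarithmicAveraging` (subsequence of scales; almost all scales; Wiener–Ikehara for non-negative sequences) remain the published partial transfers [cite: TaoTeravainen2019AlmostAllScales, §1 (p. 5) and Corollaries 1.13–1.14].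
scope_caveats: like `LogarithmicAveraging`, a statement about transfer SCHEMAS over classes of real sequences cut out by soft properties; it does not say that the almost-all-scales results for `λ(n)λ(n+h)` cannot be upgraded using multiplicativity, sieve structure or bilinear/expander estimates of a new kind — that question is unsettled in print ("We do not know how to do so in general"), and this record is not a no-go for it [cite: TaoTeravainen2019AlmostAllScales, §1 (p. 7)]; the bump–dip sequence is `{0, 1/2, 1}`-valued (a `{0,1}`-valued variant replaces `1/2` by the indicator of the even numbers; not formalised), so (ii) is stated for `[0,1]`-valued, `1`-bounded, and non-negative-with-partial-sums-`≤ X` classes; `HasLogBanachDensityZero` divides by `log ω` where Tao–Teräväinen divide by `∑_{X/ω≤n≤X} 1/n = log ω + O(1)` (same null sets) [cite: TaoTeravainen2019AlmostAllScales, Corollary 1.8 (i)]; the converse direction "almost all scales ⟹ the windowed logarithmic statement" (partial summation) and the Dirichlet-series example `a_n = 1 + cos log n` are quoted, not formalised [cite: TaoTeravainen2019AlmostAllScales, Remark 1.10]; the statements about where the logarithm enters the methods ((iv) of `because:`) describe the printed identities and are not theorems [cite: HelfgottRadziwill2021, Corollary 1.4].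
status: established — PROVED (`LogarithmicAveragingScope_holds`); audit outcome for `LogarithmicAveraging`: CONFIRMED (2026-08-16), technique class sharpened here -/
def LogarithmicAveragingScope : Prop :=
  (¬ WindowToMeanTransfer {a : ℕ → ℝ | ∀ n, a n = 0 ∨ a n = 1}) ∧
    (¬ AAScalesToMeanTransfer {a : ℕ → ℝ | ∀ n, 0 ≤ a n ∧ a n ≤ 1}) ∧
    ∀ (a : ℕ → ℝ) (B α : ℝ), (∀ n, |a n| ≤ B) →
      (∀ ε : ℝ, 0 < ε → ∃ X₀ : ℕ, ∀ X : ℕ, X₀ ≤ X →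
        ∃ X' : ℕ, X ≤ X' ∧ (X' : ℝ) ≤ (1 + ε) * X ∧ |cesaroMean a X' - α| ≤ ε) →
      HasMeanValue a α

/-- **The scope record holds** (proved: Hall's set, the bump–dip sequence, the log-Lipschitz
estimate). [cite: TaoTeravainen2019AlmostAllScales, §1 (p. 7) and Remark 1.11] -/
theorem LogarithmicAveragingScope_holds : LogarithmicAveragingScope :=
  ⟨not_windowToMeanTransfer_indicator, not_aaScalesToMeanTransfer_unitInterval,
    fun _ _ _ hB h => hasMeanValue_of_goodScale_nearby hB h⟩

end Literature.Barriers.Parity
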